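import Mathlib.Order.Filter.FilterProduct
import Mathlib.FieldTheory.IsAlgClosed.Basic
import Mathlib.Algebra.Polynomial.FieldDivision
import Mathlib.RingTheory.LaurentSeries
import Literature.Computability.AlgebraicComplexity.ApproximationOrderBound
import Literature.Computability.AlgebraicComplexity.AlderStrassenProofs
import HarnessLib

/-!
# A uniform bound on the order of approximation (Lehmkuhl–Lickteig 1989): proof file

Sibling proof file of `Literature/Computability/AlgebraicComplexity/ApproximationOrderBound.lean`,
discharging its named fact
`Literature.Computability.AlgebraicComplexity.LehmkuhlLickteig1989_approxOrder_bound`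
(T. Lehmkuhl, T. Lickteig, *On the order of approximation in approximative triadic
decompositions of tensors*, Theoret. Comput. Sci. 66 (1989) 1–14 [LehmkuhlLickteig1989], main
Theorem, (ii) `⇒` (iii), in its QUALITATIVE form: for every format `a × b × c` and every `r`
there is one order `H` such that every complex tensor of border rank `R̲(t) ≤ r` satisfies
`R_H(t) ≤ r`).

## The argument formalised here, and why it is not the printed one

The paper proves an EXPLICIT bound — order `h = δ ^ r`, `δ = (n+m+l−3)!/((n−1)!(m−1)!(l−1)!)` the
degree of the Segre variety (p. 2, Theorem; p. 12, `h := deg graph ψ = deg Sʳ = (deg S)^r`; primary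
source read 2026-08-15, see the statement file's module docstring; the explicit statement belongs to
the statement file — named fact `LehmkuhlLickteig1989_explicitOrderBound`, printed order
`lehmkuhlLickteigPowOrder n m l r = segreDegree n m l ^ r` — and is NOT discharged here) — by an effective
version of A. Alder's theorem (curve selection with degree control, pole orders at places of the
curve). The vendored fact discharged here is only the qualitative consequence, and for it the
tree already provides the decisive ingredient — **Alder's theorem for every algebraically closed field**
(`alder_secantVariety_eq_setOf_algBorderRank_le_holds`, BCS Thm. (20.3),
`AlderStrassenProofs.lean`) — from which uniformity follows by a routine COMPACTNESS argument,
carried out with an ultrapower (Mathlib's `Filter.Germ` along the free ultrafilter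
`Filter.hyperfilter ℕ`, a field by `Mathlib.Order.Filter.FilterProduct`) and the fragment of
Łoś's theorem needed, proved by hand for the polynomial identities involved:

* §0 `approxRank_le_approxRank_of_le`: `R_h` is antitone in `h` (Bläser 2013, Rem. 6.2).
* §1 transfer of polynomial identities between `Germ l R`, `α → R` and the coordinates `R`.
* §2 `isAlgClosed_germ`: an ultrapower of an algebraically closed field is algebraically closed.
* §3 the secant parametrisation `σ_r` (BCS §20.1; the tree's `secantParametrisation` and its
  base changes `MvPolynomial.map g (secantParametrisation …)`), the dictionary "`P` vanishes on
  `S_r`" `↔` "`P ∘ σ_r = 0`" over infinite domains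
  (`eval_eq_zero_of_bind₁_secantParametrisation`, `bind₁_secantParametrisation_eq_zero`), and
  the two transfers: `germ_mem_tensorZariskiClosure` (the complex secant variety transfers UP to
  the ultrapower) and `eventually_approxRank_le` (approximate decompositions of a fixed order
  transfer DOWN to almost every coordinate).
* §4 `LehmkuhlLickteig1989_approxOrder_bound_holds`: if no `H` worked, tensors `t_k` with
  `R̲(t_k) ≤ r < R_k(t_k)` would give a germ `T = [t_k]` in `X_r(ℂ^ℕ/U)` (easy inclusion
  `{R̲ ≤ r} ⊆ X_r` coordinatewise, §3), hence `R̲(T) ≤ r` by Alder over `ℂ^ℕ/U`, hence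
  `R_{h₀}(T) ≤ r` for some `h₀`, hence `R_{h₀}(t_k) ≤ r` for almost all `k` (§3), contradicting
  `R_k(t_k) ≤ R_{h₀}(t_k)` for `k ≥ h₀` (§0).

This is the standard model-theoretic route from a pointwise statement over all algebraically
closed fields to a uniform one (ℵ₁-saturation of ultrapowers); it gives no explicit `H`.

## Two PROVED fragments of the printed, explicit theorem (2026-08-15)

* §5 `LehmkuhlLickteig1989_explicitOrderBound_of_le_one`: the case `r ≤ 1` of
  `LehmkuhlLickteig1989_explicitOrderBound`, over EVERY field and at every order — an approximate
  decomposition with one triad forces rank `≤ 1` (lowest-order coefficients;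
  `tensorRank_le_one_of_algBorderRank_le_one`), with none it forces `t = 0`.
* §6 `approxRank_le_of_poleOrder_le` (and `…_of_minors`): the paper's own final step (§6,
  pp. 12–13) in the tree's valuation-ring language — rank-one tensors `s_ρ` over the fraction
  field of a valuation ring `D ⊇ K` (residue classes represented by `K`, maximal ideal `(ϖ)`)
  whose entries have poles of order `≤ h` and whose sum is `≡ t (mod 𝔪_D)` give `R_h(t) ≤ r`
  (pivot rescaling of `v_ρ, w_ρ`, `ϖ^h u_ρ`, truncation of `ϖ`-adic expansions =
  `exists_curve_of_aeval_eq_pow_mul` of `AlderStrassenProofs.lean`). What the tree still lacks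
  for the full explicit theorem is exactly the INPUT of §6: a place of a curve `C ⊆ Sʳ` with
  `t ∈ cl ψ(C)` at which the coordinate functions have poles of order `≤ deg C ≤ deg Sʳ = δ^r`
  (Prop. 1: curve selection with degree control by the affine Bézout inequality; Prop. 3 and
  its Corollary: pole order `≤ i(C,H;y₀) ≤ deg C` by Bézout's theorem for a curve and a
  hyperplane; `deg S = δ` by the Hilbert polynomial of the Segre variety) — degree theory
  Mathlib does not have.
* §7 `algebraMap_notMem_maximalIdeal_pow_succ_finrank_of_transcendental` (and its abstract
  core `algebraMap_notMem_maximalIdeal_pow_succ_finrank`): the function-field half of Prop. 3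
  (pp. 11–12: the normalisation `B` is free of rank `d = [K(C) : k(u)]` over `k[u]`, and the
  orders `e_i` of `u` at the places over `u = 0` satisfy `e_i ≤ ∑ e_j = d`) — for `u`
  transcendental with `F/K(u)` finite separable, `B` the integral closure of `K[u]` in `F` and
  `Q ∋ u` a maximal ideal of `B`: `u ∉ 𝔪_{B_Q}^{d+1}`, i.e. `ord_Q(u) ≤ [F : K(u)]`. With the
  pivot lemma of §6 this bounds the pole orders of the coordinate functions at a place by
  `[K(C) : K(y_j)]` for a pivot coordinate `y_j`; the remaining input, `[K(C) : K(y_j)] ≤ deg C ≤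
  deg Sʳ = δ^r` for a curve selected as in Prop. 1, is the degree theory proper.
* §8 **The printed proof's spine, closed modulo its degree-theoretic input.**
  `LehmkuhlLickteig1989_explicitOrderBound_of_poleOrderBound` derives the named fact
  `LehmkuhlLickteig1989_explicitOrderBound` from the explicit hypothesis that every
  `t ∈ X_r ∖ S_r` admits a place of a function field in one variable with an `E`-point of `Sʳ`
  reducing to `t` whose entries have poles of order `≤ δ^r` (the tree-language form of LL89's
  "Proposition 1 and the corollary to Proposition 3", p. 12; `exists_uniformizer_of_valuationSubring`:
  such a place is a discrete valuation ring with residue field `K`, BCS Lemma (20.28); then §6).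
  `LehmkuhlLickteig1989_explicitOrderBound_of_degreeBound` derives it one layer lower, from a
  pivot entry `g` with `[E : K(g⁻¹)] ≤ δ^r` (`notMem_maximalIdeal_pow_succ_of_finrank_le` = §7
  read in the place). `LehmkuhlLickteig1989_explicitOrderBound_of_laurentPoints` is the printed
  Corollary (a) verbatim (formal Laurent series `s_{ρijk} ∈ k((ε))`, `ord ≥ −δ^r`, relations of
  `Sʳ`, `(∑_ρ s_ρ)(ε=0) = t`) ⇒ the fact, by §6 with `D = k[[ε]]`. What either hypothesis still asks for is exactly Prop. 1 (curve selection
  with `deg C ≤ deg Sʳ`, affine Bézout inequality) with `deg Sʳ = δ^r` and `[K(C) : K(g)] ≤ deg C`: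
  the degree theory of affine varieties (Heintz 1983), absent from Mathlib.

## References

* T. Lehmkuhl, T. Lickteig, *On the order of approximation in approximative triadic
  decompositions of tensors*, Theoret. Comput. Sci. 66 (1989) 1–14,
  doi:10.1016/0304-3975(89)90141-2 (Elsevier open archive; CORE output 82165201); Zbl 0678.15024.
  [LehmkuhlLickteig1989]
* P. Bürgisser, M. Clausen, M. A. Shokrollahi, *Algebraic Complexity Theory*, Grundlehren 315,
  Springer (1997), §20.1, Thm. (20.3) (Alder), §20.7 Notes p. 569.
  [BurgisserClausenShokrollahi1997]
* M. Bläser, *Fast Matrix Multiplication*, Theory of Computing Graduate Surveys 5 (2013),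
  Def. 6.1, Rem. 6.2. [Blaser2013]
-/

noncomputable section

open scoped BigOperators Polynomial
open MvPolynomial

namespace Literature.Computability.AlgebraicComplexity

universe u v₁ v₂ v₃

/-! ### §0. `R_h` is antitone in `h` -/

section Antitone

variable {K : Type u} [CommSemiring K] {ι : Type v₁} {κ : Type v₂} {μ : Type v₃}
  [Fintype ι] [Fintype κ] [Fintype μ] [DecidableEq ι] [DecidableEq κ] [DecidableEq μ]

/-- `R_{h'}(t) ≤ R_h(t)` for `h ≤ h'` (finite index types): iterate Bläser's Remark 6.2(2),
`approxRank_succ_le`. [cite: Blaser2013, Rem. 6.2] -/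
theorem approxRank_le_approxRank_of_le {h h' : ℕ} (hle : h ≤ h') (t : ι → κ → μ → K) :
    approxRank h' t ≤ approxRank h t := by
  induction hle with
  | refl => exact le_rfl
  | step _ ih => exact (approxRank_succ_le (exists_isApproxDecomposition _ t)).trans ih

end Antitone

/-! ### §1. Ultrapowers: transfer of polynomial identities

For a filter `l` on `α` and a commutative ring `R`, the germ map `(α → R) →+* Germ l R` is a
surjective ring homomorphism (`Filter.Germ.coeRingHom`), and so is the evaluation
`(α → R) →+* R` at every `k : α`. A polynomial identity over `Germ l R` lifts to `α → R` and
holds at `l`-almost every coordinate `k` (finitely many coefficients are involved): the fragment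
of Łoś's theorem needed here, proved by hand. -/

section Germ

open Filter

variable {α : Type*} (l : Filter α) {R : Type*} [CommSemiring R]

/-- The germ map `(α → R) → Germ l R` is surjective. [folklore] -/
theorem germ_coeRingHom_surjective :
    Function.Surjective (Germ.coeRingHom l : (α → R) → Germ l R) := fun q =>
  Germ.inductionOn q fun f => ⟨f, rfl⟩

/-- A multivariate polynomial over `α → R` whose germ is zero vanishes at `l`-almost every
coordinate (finitely many coefficients). [folklore] -/
theorem eventually_map_evalRingHom_eq_zero {τ : Type*} {Q : MvPolynomial τ (α → R)}
    (hQ : MvPolynomial.map (Germ.coeRingHom l) Q = 0) :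
    ∀ᶠ k in l, MvPolynomial.map (Pi.evalRingHom (fun _ : α => R) k) Q = 0 := by
  have hcoeff : ∀ m ∈ Q.support, ∀ᶠ k in l, Q.coeff m k = 0 := by
    intro m _
    have h1 : (Germ.coeRingHom l) (Q.coeff m) = 0 := by
      rw [← MvPolynomial.coeff_map, hQ, MvPolynomial.coeff_zero]
    have h2 : ((Q.coeff m : α → R) : Germ l R) = ((0 : α → R) : Germ l R) := by
      rw [Germ.coe_zero]
      exact h1
    exact (Germ.coe_eq.1 h2).mono fun k hk => hk
  have hall := (Filter.eventually_all_finset Q.support).2 hcoeff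
  refine hall.mono fun k hk => ?_
  ext m
  rw [MvPolynomial.coeff_map, MvPolynomial.coeff_zero]
  by_cases hm : m ∈ Q.support
  · exact hk m hm
  · rw [MvPolynomial.notMem_support_iff.1 hm, map_zero]

/-- Evaluation commutes with taking germs. [folklore] -/
theorem eval_map_coeRingHom {τ : Type*} (x : τ → α → R) (Q : MvPolynomial τ (α → R)) :
    MvPolynomial.eval (fun i => (x i : Germ l R)) (MvPolynomial.map (Germ.coeRingHom l) Q) =
      ((MvPolynomial.eval x Q : α → R) : Germ l R) := by
  rw [MvPolynomial.eval_map]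
  change _ = Germ.coeRingHom l (MvPolynomial.eval₂ (RingHom.id _) x Q)
  rw [MvPolynomial.eval₂_comp_left, RingHom.comp_id]
  rfl

/-- Evaluation commutes with evaluation at a coordinate. [folklore] -/
theorem eval_apply_eq_eval_map_evalRingHom {τ : Type*} (x : τ → α → R)
    (Q : MvPolynomial τ (α → R)) (k : α) :
    MvPolynomial.eval x Q k =
      MvPolynomial.eval (fun i => x i k)
        (MvPolynomial.map (Pi.evalRingHom (fun _ : α => R) k) Q) := by
  rw [MvPolynomial.eval_map]
  change Pi.evalRingHom (fun _ : α => R) k (MvPolynomial.eval₂ (RingHom.id _) x Q) = _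
  rw [MvPolynomial.eval₂_comp_left, RingHom.comp_id]
  rfl

/-- Univariate evaluation commutes with taking germs. [folklore] -/
theorem polynomial_eval_map_coeRingHom (z : α → R) (q : (α → R)[X]) :
    (q.map (Germ.coeRingHom l)).eval (z : Germ l R) = ((q.eval z : α → R) : Germ l R) := by
  rw [Polynomial.eval_map]
  exact Polynomial.eval₂_hom (Germ.coeRingHom l) z

/-- Univariate evaluation commutes with evaluation at a coordinate. [folklore] -/
theorem polynomial_eval_apply (z : α → R) (q : (α → R)[X]) (k : α) :
    q.eval z k = (q.map (Pi.evalRingHom (fun _ : α => R) k)).eval (z k) := by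
  rw [Polynomial.eval_map]
  exact (Polynomial.eval₂_hom (Pi.evalRingHom (fun _ : α => R) k) z).symm

end Germ

/-! ### §2. An ultrapower of an algebraically closed field is algebraically closed -/

section AlgClosed

open Filter

variable {α : Type*} (φ : Ultrafilter α) (K : Type*) [Field K] [IsAlgClosed K]

/-- **Łoś for "every monic polynomial of degree `n ≥ 1` has a root"**: an ultrapower
`K^α / φ` of an algebraically closed field is algebraically closed (roots are chosen
coordinatewise for a coordinatewise-monic lift of the polynomial). [folklore] -/
theorem isAlgClosed_germ : IsAlgClosed (Germ (φ : Filter α) K) := by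
  haveI : Nonempty α := Filter.nonempty_of_neBot (φ : Filter α)
  refine IsAlgClosed.of_exists_root _ fun p hp hirr => ?_
  set n := p.natDegree with hn
  have hn0 : 0 < n :=
    Polynomial.natDegree_pos_iff_degree_pos.2 (Polynomial.degree_pos_of_irreducible hirr)
  -- lift the lower coefficients of `p` to `α → K`
  choose c hc using fun i : Fin n => germ_coeRingHom_surjective (φ : Filter α) (p.coeff i)
  -- a monic lift `Q` of `p`
  set Q : (α → K)[X] :=
    Polynomial.X ^ n + ∑ i : Fin n, Polynomial.C (c i) * Polynomial.X ^ (i : ℕ) with hQ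
  have hdeg : (∑ i : Fin n, Polynomial.C (c i) * Polynomial.X ^ (i : ℕ)).degree <
      (n : WithBot ℕ) :=
    Polynomial.degree_sum_fin_lt c
  have hQmonic : Q.Monic := Polynomial.monic_X_pow_add hdeg
  have hQdeg : Q.natDegree = n := by
    rw [hQ, Polynomial.natDegree_add_eq_left_of_degree_lt, Polynomial.natDegree_X_pow]
    rwa [Polynomial.degree_X_pow]
  have hQmap : Q.map (Germ.coeRingHom (φ : Filter α)) = p := by
    rw [hQ, Polynomial.map_add, Polynomial.map_pow, Polynomial.map_X, Polynomial.map_sum]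
    conv_rhs =>
      rw [hp.as_sum, ← hn,
        Finset.sum_range (fun i => Polynomial.C (p.coeff i) * Polynomial.X ^ i)]
    congr 1
    refine Finset.sum_congr rfl fun i _ => ?_
    rw [Polynomial.map_mul, Polynomial.map_C, Polynomial.map_pow, Polynomial.map_X, hc]
  -- roots coordinatewise
  have hroot : ∀ k : α, ∃ z : K, (Q.map (Pi.evalRingHom (fun _ : α => K) k)).IsRoot z := by
    intro k
    apply IsAlgClosed.exists_root
    have hmk := hQmonic.map (Pi.evalRingHom (fun _ : α => K) k)
    rw [Polynomial.degree_eq_natDegree hmk.ne_zero, hQmonic.natDegree_map, hQdeg]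
    exact_mod_cast hn0.ne'
  choose z hz using hroot
  refine ⟨((z : α → K) : Germ (φ : Filter α) K), ?_⟩
  rw [← hQmap, polynomial_eval_map_coeRingHom]
  have hz0 : Q.eval z = 0 := by
    funext k
    rw [polynomial_eval_apply]
    exact hz k
  rw [hz0, Germ.coe_zero]

end AlgClosed

/-! ### §3. The secant variety over an ultrapower

The secant parametrisation `σ_r` of BCS §20.1 (the tree's `secantParametrisation ι κ μ r`,
with coefficients in `ℂ`) is used over three coefficient rings at once — `ℂ`, `α → ℂ` and the
ultrapower `Germ φ ℂ` — through its base changes `MvPolynomial.map g (secantParametrisation …)`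
along `g : ℂ →+* L` (it is defined over `ℤ`, so nothing is lost). -/

section Secant

open Filter

variable {ι κ μ : Type}

/-- Evaluating (any base change of) the secant parametrisation at a point gives the flattening of
the corresponding sum of `r` triads (BCS §20.1: `S_r(f) = im σ_r`; the tree's
`aeval_secantParametrisation` is the case `L = ℂ`).
[cite: BurgisserClausenShokrollahi1997, §20.1 (σ_r)] -/
theorem eval_map_secantParametrisation {L : Type*} [CommSemiring L] (g : ℂ →+* L) (r : ℕ)
    (y : (Fin r × ι) ⊕ ((Fin r × κ) ⊕ (Fin r × μ)) → L) (x : ι × κ × μ) :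
    eval y (MvPolynomial.map g (secantParametrisation ι κ μ r x)) =
      uncurryTensor (∑ ρ : Fin r, triad (fun a => y (Sum.inl (ρ, a)))
        (fun b => y (Sum.inr (Sum.inl (ρ, b)))) (fun c => y (Sum.inr (Sum.inr (ρ, c))))) x := by
  obtain ⟨a, b, c⟩ := x
  simp only [secantParametrisation, map_sum, map_mul, MvPolynomial.map_X, eval_X,
    uncurryTensor_apply, Finset.sum_apply, triad_apply]

/-- Over an infinite integral domain `L` a polynomial vanishing on the set `S_r` of tensors of
rank `≤ r` is killed by composition with `σ_r` (a polynomial vanishing at all points is zero).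
[cite: BurgisserClausenShokrollahi1997, §20.1 (S_r(f) = im σ_r)] -/
theorem bind₁_secantParametrisation_eq_zero {L : Type*} [CommRing L] [IsDomain L] [Infinite L]
    (g : ℂ →+* L) {r : ℕ} {P : MvPolynomial (ι × κ × μ) L}
    (hP : ∀ s : ι → κ → μ → L, tensorRank s ≤ r → eval (uncurryTensor s) P = 0) :
    bind₁ (fun x => MvPolynomial.map g (secantParametrisation ι κ μ r x)) P = 0 := by
  apply MvPolynomial.funext
  intro y
  rw [map_zero]
  have hfun : (fun x : ι × κ × μ =>
      eval y (MvPolynomial.map g (secantParametrisation ι κ μ r x))) =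
        uncurryTensor (∑ ρ : Fin r, triad (fun a => y (Sum.inl (ρ, a)))
          (fun b => y (Sum.inr (Sum.inl (ρ, b)))) (fun c => y (Sum.inr (Sum.inr (ρ, c))))) := by
    funext x
    exact eval_map_secantParametrisation g r y x
  calc eval y (bind₁ (fun x => MvPolynomial.map g (secantParametrisation ι κ μ r x)) P)
      = aeval y (bind₁ (fun x => MvPolynomial.map g (secantParametrisation ι κ μ r x)) P) := rfl
    _ = aeval (fun x => aeval y (MvPolynomial.map g (secantParametrisation ι κ μ r x))) P :=
        aeval_bind₁ _ _ _
    _ = eval (uncurryTensor (∑ ρ : Fin r, triad (fun a => y (Sum.inl (ρ, a)))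
          (fun b => y (Sum.inr (Sum.inl (ρ, b)))) (fun c => y (Sum.inr (Sum.inr (ρ, c)))))) P := by
        rw [← hfun]
        rfl
    _ = 0 := hP _ (tensorRank_le_of_eq_sum _ _ _ rfl)

variable [Fintype ι] [Fintype κ] [Fintype μ]

/-- Conversely (over `ℂ`), a polynomial killed by composition with `σ_r` vanishes on `S_r`, the
image of `σ_r` (`range_secantParametrisation`).
[cite: BurgisserClausenShokrollahi1997, §20.1 (S_r(f) = im σ_r)] -/
theorem eval_eq_zero_of_bind₁_secantParametrisation {r : ℕ} {P : MvPolynomial (ι × κ × μ) ℂ}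
    (hP : bind₁ (secantParametrisation ι κ μ r) P = 0) {s : ι → κ → μ → ℂ}
    (hs : tensorRank s ≤ r) : eval (uncurryTensor s) P = 0 := by
  classical
  have hmem : uncurryTensor s ∈ uncurryTensor '' {s : ι → κ → μ → ℂ | tensorRank s ≤ r} :=
    ⟨s, hs, rfl⟩
  rw [← range_secantParametrisation] at hmem
  obtain ⟨y, hy⟩ := hmem
  rw [← hy]
  change aeval (fun x => aeval y (secantParametrisation ι κ μ r x)) P = 0
  rw [← aeval_bind₁, hP, map_zero]

variable {α : Type*} (φ : Ultrafilter α)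

/-- **The secant variety transfers up to the ultrapower.** If every coordinate `t_k` lies in
the complex secant variety `X_r`, then the germ tensor `[t_k]` lies in the secant variety `X_r`
over the ultrapower `ℂ^α/φ`: a polynomial `P` over the ultrapower vanishing on `S_r` is killed by
composition with `σ_r` (`bind₁_secantParametrisation_eq_zero`); lifting `P` to a polynomial `Q`
over `α → ℂ`, the composite `Q ∘ σ_r` has germ zero, hence vanishes at almost every coordinate
`k`, where `Q_k` then vanishes on `S_r(ℂ)` and so at `t_k ∈ X_r(ℂ)`; thus
`P([t]) = [Q_k(t_k)] = 0`. [folklore] -/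
theorem germ_mem_tensorZariskiClosure (r : ℕ) (t : α → ι → κ → μ → ℂ)
    (ht : ∀ k, t k ∈ tensorZariskiClosure {s : ι → κ → μ → ℂ | tensorRank s ≤ r}) :
    (fun a b c => ((fun k => t k a b c : α → ℂ) : Germ (φ : Filter α) ℂ)) ∈
      tensorZariskiClosure {s : ι → κ → μ → Germ (φ : Filter α) ℂ | tensorRank s ≤ r} := by
  classical
  haveI : Infinite (Germ (φ : Filter α) ℂ) :=
    Infinite.of_injective (fun x : ℂ => ((fun _ => x : α → ℂ) : Germ (φ : Filter α) ℂ))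
      fun a b hab => Germ.const_inj.1 hab
  rw [mem_tensorZariskiClosure_iff]
  intro P hP
  -- (i) `P ∘ σ_r = 0` over the ultrapower
  have hbind := bind₁_secantParametrisation_eq_zero
    ((Germ.coeRingHom (φ : Filter α)).comp (Pi.constRingHom α ℂ)) hP
  -- (ii) lift `P` to `α → ℂ`
  obtain ⟨Q, rfl⟩ := MvPolynomial.map_surjective (Germ.coeRingHom (φ : Filter α))
    (germ_coeRingHom_surjective (φ : Filter α)) P
  -- (iii) the germ of `Q ∘ σ_r` vanishes
  have hmap : MvPolynomial.map (Germ.coeRingHom (φ : Filter α))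
      (bind₁ (fun x => MvPolynomial.map (Pi.constRingHom α ℂ) (secantParametrisation ι κ μ r x))
        Q) = 0 := by
    rw [MvPolynomial.map_bind₁]
    simp only [MvPolynomial.map_map]
    exact hbind
  -- (iv) hence `Q_k ∘ σ_r = 0` for almost every `k`, so `Q_k` vanishes at `t_k`
  have hev : ∀ᶠ k in (φ : Filter α), MvPolynomial.eval (uncurryTensor (t k))
      (MvPolynomial.map (Pi.evalRingHom (fun _ : α => ℂ) k) Q) = 0 := by
    refine (eventually_map_evalRingHom_eq_zero (φ : Filter α) hmap).mono fun k hk => ?_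
    rw [MvPolynomial.map_bind₁] at hk
    simp only [MvPolynomial.map_map] at hk
    have hcomp : (Pi.evalRingHom (fun _ : α => ℂ) k).comp (Pi.constRingHom α ℂ) = RingHom.id ℂ :=
      RingHom.ext fun _ => rfl
    simp only [hcomp, MvPolynomial.map_id] at hk
    exact (mem_tensorZariskiClosure_iff _ _).1 (ht k) _ fun s hs =>
      eval_eq_zero_of_bind₁_secantParametrisation hk hs
  -- (v) `P([t]) = [Q_k(t_k)] = 0`
  have huncurry :
      uncurryTensor (fun a b c => ((fun k => t k a b c : α → ℂ) : Germ (φ : Filter α) ℂ)) =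
        fun x => ((fun k => uncurryTensor (t k) x : α → ℂ) : Germ (φ : Filter α) ℂ) := by
    funext x
    rfl
  rw [huncurry, eval_map_coeRingHom]
  rw [← Germ.coe_zero, Germ.coe_eq]
  refine hev.mono fun k hk => ?_
  rw [eval_apply_eq_eval_map_evalRingHom]
  exact hk

variable {K : Type u} [Field K]

/-- **Approximate decompositions transfer down from the ultrapower.** If the germ tensor
`[t_k]` has an approximate decomposition of order `h` with `≤ r` triads over `K^α/φ`, then so
does `t_k` over `K` for `φ`-almost every `k`: lift the polynomial vectors to `(α → K)[ε]`; the
finitely many defining coefficient identities hold at almost every coordinate. [folklore] -/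
theorem eventually_approxRank_le (h : ℕ) (t : α → ι → κ → μ → K) {r : ℕ}
    (hT : approxRank h
      (fun a b c => ((fun k => t k a b c : α → K) : Germ (φ : Filter α) K)) ≤ r) :
    ∀ᶠ k in (φ : Filter α), approxRank h (t k) ≤ r := by
  classical
  set T : ι → κ → μ → Germ (φ : Filter α) K :=
    fun a b c => ((fun k => t k a b c : α → K) : Germ (φ : Filter α) K) with hTdef
  obtain ⟨u, v, w, huvw⟩ := approxRank_attained h T
  have hsurj : Function.Surjective
      (Polynomial.map (Germ.coeRingHom (φ : Filter α)) :
        (α → K)[X] → (Germ (φ : Filter α) K)[X]) :=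
    Polynomial.map_surjective _ (germ_coeRingHom_surjective (φ : Filter α))
  choose U hU using fun ρ a => hsurj (u ρ a)
  choose V hV using fun ρ b => hsurj (v ρ b)
  choose W hW using fun ρ c => hsurj (w ρ c)
  -- the lifted entry polynomials
  have hS : ∀ a b c, (∑ ρ, U ρ a * V ρ b * W ρ c).map (Germ.coeRingHom (φ : Filter α)) =
      ∑ ρ, u ρ a * v ρ b * w ρ c := by
    intro a b c
    rw [Polynomial.map_sum]
    refine Finset.sum_congr rfl fun ρ _ => ?_
    rw [Polynomial.map_mul, Polynomial.map_mul, hU, hV, hW]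
  -- each defining coefficient identity holds almost everywhere
  have hev : ∀ a b c, ∀ j : Fin (h + 1), ∀ᶠ k in (φ : Filter α),
      (∑ ρ, U ρ a * V ρ b * W ρ c).coeff j k = if (j : ℕ) = h then t k a b c else 0 := by
    intro a b c j
    have h1 := huvw a b c j (Nat.lt_succ_iff.1 j.is_lt)
    rw [← hS, Polynomial.coeff_map] at h1
    have h2 : (((∑ ρ, U ρ a * V ρ b * W ρ c).coeff j : α → K) : Germ (φ : Filter α) K) =
        ((fun k => if (j : ℕ) = h then t k a b c else 0 : α → K) : Germ (φ : Filter α) K) := by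
      refine h1.trans ?_
      split_ifs
      · rfl
      · exact Germ.coe_zero.symm
    exact (Germ.coe_eq.1 h2).mono fun k hk => hk
  have hall : ∀ᶠ k in (φ : Filter α), ∀ a b c, ∀ j : Fin (h + 1),
      (∑ ρ, U ρ a * V ρ b * W ρ c).coeff j k = if (j : ℕ) = h then t k a b c else 0 := by
    simp only [Filter.eventually_all]
    exact hev
  refine hall.mono fun k hk => ?_
  -- the specialised decomposition at the coordinate `k`
  have happrox : IsApproxDecomposition h (t k)
      (fun ρ a => (U ρ a).map (Pi.evalRingHom (fun _ : α => K) k))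
      (fun ρ b => (V ρ b).map (Pi.evalRingHom (fun _ : α => K) k))
      (fun ρ c => (W ρ c).map (Pi.evalRingHom (fun _ : α => K) k)) := by
    intro a b c j hj
    have e : (∑ ρ, (U ρ a).map (Pi.evalRingHom (fun _ : α => K) k) *
        (V ρ b).map (Pi.evalRingHom (fun _ : α => K) k) *
          (W ρ c).map (Pi.evalRingHom (fun _ : α => K) k)) =
        (∑ ρ, U ρ a * V ρ b * W ρ c).map (Pi.evalRingHom (fun _ : α => K) k) := by
      rw [Polynomial.map_sum]
      refine Finset.sum_congr rfl fun ρ _ => ?_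
      rw [Polynomial.map_mul, Polynomial.map_mul]
    rw [e, Polynomial.coeff_map]
    exact hk a b c ⟨j, Nat.lt_succ_of_le hj⟩
  exact (approxRank_le_of_isApproxDecomposition happrox).trans hT

end Secant

/-! ### §4. The theorem -/

section Main

open Filter

/-- **Lehmkuhl–Lickteig 1989, qualitative form** — discharge of the named fact
`LehmkuhlLickteig1989_approxOrder_bound`: for every format `a × b × c` and every `r` there is
ONE order `H` with `R̲(t) ≤ r ⇒ R_H(t) ≤ r` for all `t ∈ ℂ^a ⊗ ℂ^b ⊗ ℂ^c`.

Proof (compactness, via an ultrapower; NOT the printed proof, which computes `H` explicitly):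
if no `H` works, choose `t_k` (`k ∈ ℕ`) with `R̲(t_k) ≤ r < R_k(t_k)`. In the ultrapower
`L = ℂ^ℕ/U` (`U` a free ultrafilter; `L` is an algebraically closed field, `isAlgClosed_germ`)
the germ tensor `T = [t_k]` lies in the secant variety `X_r(L)` (each `t_k ∈ X_r(ℂ)` by the
elementary inclusion `setOf_algBorderRank_le_subset_tensorZariskiClosure`, then
`germ_mem_tensorZariskiClosure`), so by **Alder's theorem over `L`**
(`alder_secantVariety_eq_setOf_algBorderRank_le_holds`) `R̲(T) ≤ r`, i.e. `R_{h₀}(T) ≤ r` for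
some `h₀`; this transfers down (`eventually_approxRank_le`): `R_{h₀}(t_k) ≤ r` for `U`-almost
all `k`, in particular for some `k ≥ h₀`, where `R_k(t_k) ≤ R_{h₀}(t_k) ≤ r` — contradiction.
[cite: LehmkuhlLickteig1989, main Theorem ((ii) ⇒ (iii)), qualitative consequence;
cf. BurgisserClausenShokrollahi1997 Thm. (20.3), §20.7 Notes p. 569] -/
theorem LehmkuhlLickteig1989_approxOrder_bound_holds : LehmkuhlLickteig1989_approxOrder_bound := by
  intro a b c r
  by_contra hcon
  push Not at hcon
  -- `t k`: border rank `≤ r` but `R_k(t k) > r`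
  choose t ht hlt using hcon
  set φ : Ultrafilter ℕ := hyperfilter ℕ
  haveI : IsAlgClosed (Germ (φ : Filter ℕ) ℂ) := isAlgClosed_germ φ ℂ
  set T : Fin a → Fin b → Fin c → Germ (φ : Filter ℕ) ℂ :=
    fun i j l => ((fun k => t k i j l : ℕ → ℂ) : Germ (φ : Filter ℕ) ℂ)
  -- `T` lies in the secant variety over the ultrapower
  have hTX : T ∈ tensorZariskiClosure
      {s : Fin a → Fin b → Fin c → Germ (φ : Filter ℕ) ℂ | tensorRank s ≤ r} :=
    germ_mem_tensorZariskiClosure φ r t fun k =>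
      setOf_algBorderRank_le_subset_tensorZariskiClosure r (ht k)
  -- Alder's theorem over the ultrapower
  have hbr : algBorderRank T ≤ r := by
    have e := alder_secantVariety_eq_setOf_algBorderRank_le_holds
      (K := Germ (φ : Filter ℕ) ℂ) (ι := Fin a) (κ := Fin b) (μ := Fin c) r
    rw [e] at hTX
    exact hTX
  obtain ⟨h₀, hh₀⟩ := algBorderRank_attained T
  have hRh : approxRank h₀ T ≤ r := hh₀ ▸ hbr
  -- transfer down, and pick a coordinate `k ≥ h₀`
  have hev : ∀ᶠ k in (φ : Filter ℕ), approxRank h₀ (t k) ≤ r :=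
    eventually_approxRank_le φ h₀ t hRh
  have hge : ∀ᶠ k in (φ : Filter ℕ), h₀ ≤ k :=
    hyperfilter_le_cofinite (Nat.cofinite_eq_atTop ▸ Filter.eventually_ge_atTop h₀)
  obtain ⟨k, hk, hk'⟩ := (hev.and hge).exists
  exact absurd (lt_of_lt_of_le (hlt k) ((approxRank_le_approxRank_of_le hk' (t k)).trans hk))
    (lt_irrefl r)

end Main

/-! ### §5. The case `r ≤ 1` of the explicit bound: border rank `≤ 1` is rank `≤ 1` -/

section RankOne

variable {K : Type u} [Field K] {ι : Type v₁} {κ : Type v₂} {μ : Type v₃}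

/-- Lowest-order normalisation of a finite family of polynomials, not all zero: `f i = X^e · g i`
with some `g i₀` not vanishing at `0` (`e` the least order of a non-zero `f i`). [folklore] -/
theorem exists_family_eq_X_pow_mul_exists_coeff_zero_ne_zero {σ : Type*} [Fintype σ] (f : σ → K[X])
    (hf : ∃ i, f i ≠ 0) :
    ∃ (e : ℕ) (g : σ → K[X]), (∀ i, f i = Polynomial.X ^ e * g i) ∧ ∃ i, (g i).coeff 0 ≠ 0 := by
  classical
  set S : Finset σ := Finset.univ.filter fun i => f i ≠ 0 with hS
  have hSne : S.Nonempty := by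
    obtain ⟨i, hi⟩ := hf
    exact ⟨i, by simp [hS, hi]⟩
  set e : ℕ := S.inf' hSne fun i => (f i).natTrailingDegree with he
  have hdvd : ∀ i, (Polynomial.X : K[X]) ^ e ∣ f i := by
    intro i
    by_cases hi : f i = 0
    · rw [hi]
      exact dvd_zero _
    · rw [Polynomial.X_pow_dvd_iff]
      intro d hd
      apply Polynomial.coeff_eq_zero_of_lt_natTrailingDegree
      have hle : e ≤ (f i).natTrailingDegree :=
        Finset.inf'_le (fun i => (f i).natTrailingDegree) (by simp [hS, hi])
      omega
  choose g hg using hdvd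
  refine ⟨e, g, hg, ?_⟩
  obtain ⟨i₀, hi₀S, hi₀⟩ := Finset.exists_mem_eq_inf' hSne fun i => (f i).natTrailingDegree
  have hfi₀ : f i₀ ≠ 0 := by simpa [hS] using hi₀S
  refine ⟨i₀, ?_⟩
  have hcoeff : (f i₀).coeff e = (g i₀).coeff 0 := by
    rw [hg i₀, Polynomial.coeff_X_pow_mul', if_pos le_rfl, Nat.sub_self]
  rw [← hcoeff, he, hi₀]
  exact mt Polynomial.trailingCoeff_eq_zero.mp hfi₀

/-- An approximate decomposition whose entries all vanish forces `t = 0`. [folklore] -/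
theorem eq_zero_of_isApproxDecomposition_of_sum_eq_zero {h : ℕ} {t : ι → κ → μ → K} {r : ℕ}
    {u : Fin r → ι → K[X]} {v : Fin r → κ → K[X]} {w : Fin r → μ → K[X]}
    (hd : IsApproxDecomposition h t u v w) (h0 : ∀ a b c, ∑ ρ, u ρ a * v ρ b * w ρ c = 0) :
    t = 0 := by
  funext a b c
  have e := hd a b c h le_rfl
  rw [if_pos rfl, h0, Polynomial.coeff_zero] at e
  exact e.symm

/-- An approximate decomposition with no triad forces `t = 0`. [folklore] -/
theorem eq_zero_of_isApproxDecomposition_zero {h : ℕ} {t : ι → κ → μ → K}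
    {u : Fin 0 → ι → K[X]} {v : Fin 0 → κ → K[X]} {w : Fin 0 → μ → K[X]}
    (hd : IsApproxDecomposition h t u v w) : t = 0 :=
  eq_zero_of_isApproxDecomposition_of_sum_eq_zero hd fun _ _ _ => Finset.sum_of_isEmpty _

variable [Fintype ι] [Fintype κ] [Fintype μ]

/-- **One triad: the lowest-order coefficients.** If `u(ε) ⊗ v(ε) ⊗ w(ε) = ε^h t + O(ε^{h+1})`
over `K[ε]`, then `t` has rank `≤ 1`: writing `u = ε^α u'`, `v = ε^β v'`, `w = ε^γ w'` with
`u'(0), v'(0), w'(0) ≠ 0`, the coefficient of `ε^{α+β+γ}` of the left-hand side is the non-zero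
triad `u'(0) ⊗ v'(0) ⊗ w'(0)`, so `α+β+γ ≥ h`, and `t = u'(0) ⊗ v'(0) ⊗ w'(0)` or `t = 0`
according as `α+β+γ = h` or `> h`. (The affine cone over the Segre variety is closed; this is the
case `r = 1` of Lehmkuhl–Lickteig's Theorem, where the printed order `δ^1 = δ` plays no role.)
[cite: LehmkuhlLickteig1989, Theorem (§1, p. 2), case r = 1] -/
theorem tensorRank_le_one_of_isApproxDecomposition_one {h : ℕ} {t : ι → κ → μ → K}
    {u : Fin 1 → ι → K[X]} {v : Fin 1 → κ → K[X]} {w : Fin 1 → μ → K[X]}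
    (hd : IsApproxDecomposition h t u v w) : tensorRank t ≤ 1 := by
  classical
  have hrk0 : t = 0 → tensorRank t ≤ 1 := fun ht => by
    rw [ht, tensorRank_zero]
    exact Nat.zero_le _
  -- if one of the three factors vanishes identically, `t = 0`
  by_cases hu : ∀ a, u 0 a = 0
  · exact hrk0 (eq_zero_of_isApproxDecomposition_of_sum_eq_zero hd fun a b c => by
      rw [Fin.sum_univ_one, hu, zero_mul, zero_mul])
  by_cases hv : ∀ b, v 0 b = 0
  · exact hrk0 (eq_zero_of_isApproxDecomposition_of_sum_eq_zero hd fun a b c => by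
      rw [Fin.sum_univ_one, hv, mul_zero, zero_mul])
  by_cases hw : ∀ c, w 0 c = 0
  · exact hrk0 (eq_zero_of_isApproxDecomposition_of_sum_eq_zero hd fun a b c => by
      rw [Fin.sum_univ_one, hw, mul_zero])
  push Not at hu hv hw
  obtain ⟨α, u', hu', a₀, ha₀⟩ := exists_family_eq_X_pow_mul_exists_coeff_zero_ne_zero (u 0) hu
  obtain ⟨β, v', hv', b₀, hb₀⟩ := exists_family_eq_X_pow_mul_exists_coeff_zero_ne_zero (v 0) hv
  obtain ⟨γ, w', hw', c₀, hc₀⟩ := exists_family_eq_X_pow_mul_exists_coeff_zero_ne_zero (w 0) hw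
  -- the entries `u_a v_b w_c = ε^(α+β+γ) · (u'_a v'_b w'_c)`
  have hentry : ∀ a b c, ∑ ρ : Fin 1, u ρ a * v ρ b * w ρ c =
      Polynomial.X ^ (α + β + γ) * (u' a * v' b * w' c) := by
    intro a b c
    rw [Fin.sum_univ_one, hu', hv', hw']
    ring
  have hcoeff0 : ∀ a b c, (u' a * v' b * w' c).coeff 0 =
      (u' a).coeff 0 * (v' b).coeff 0 * (w' c).coeff 0 := by
    intro a b c
    rw [Polynomial.mul_coeff_zero, Polynomial.mul_coeff_zero]
  rcases lt_trichotomy (α + β + γ) h with hlt | heq | hgt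
  · -- `α+β+γ < h`: the coefficient of `ε^(α+β+γ)` at `(a₀, b₀, c₀)` is non-zero but must vanish
    exfalso
    have e := hd a₀ b₀ c₀ (α + β + γ) hlt.le
    rw [if_neg hlt.ne, hentry, Polynomial.coeff_X_pow_mul', if_pos le_rfl, Nat.sub_self,
      hcoeff0] at e
    exact mul_ne_zero (mul_ne_zero ha₀ hb₀) hc₀ e
  · -- `α+β+γ = h`: `t = u'(0) ⊗ v'(0) ⊗ w'(0)`
    refine tensorRank_le_of_eq_sum (r := 1) (fun _ a => (u' a).coeff 0) (fun _ b => (v' b).coeff 0)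
      (fun _ c => (w' c).coeff 0) ?_
    funext a b c
    have e := hd a b c h le_rfl
    rw [if_pos rfl, hentry, heq, Polynomial.coeff_X_pow_mul', if_pos le_rfl, Nat.sub_self,
      hcoeff0] at e
    rw [Finset.sum_apply, Finset.sum_apply, Finset.sum_apply, Fin.sum_univ_one, triad_apply]
    exact e.symm
  · -- `α+β+γ > h`: every coefficient of order `h` vanishes, `t = 0`
    refine hrk0 (funext fun a => funext fun b => funext fun c => ?_)
    have e := hd a b c h le_rfl
    rw [if_pos rfl, hentry, Polynomial.coeff_X_pow_mul', if_neg (not_le.mpr hgt)] at e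
    exact e.symm

/-- With at most one triad, an approximate decomposition of any order forces rank `≤ 1`.
[cite: LehmkuhlLickteig1989, Theorem (§1, p. 2), case r ≤ 1] -/
theorem tensorRank_le_one_of_isApproxDecomposition_le_one {h r : ℕ} (hr : r ≤ 1)
    {t : ι → κ → μ → K} {u : Fin r → ι → K[X]} {v : Fin r → κ → K[X]} {w : Fin r → μ → K[X]}
    (hd : IsApproxDecomposition h t u v w) : tensorRank t ≤ 1 := by
  rcases Nat.le_one_iff_eq_zero_or_eq_one.mp hr with rfl | rfl
  · rw [eq_zero_of_isApproxDecomposition_zero hd, tensorRank_zero]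
    exact Nat.zero_le _
  · exact tensorRank_le_one_of_isApproxDecomposition_one hd

/-- **Border rank `≤ 1` is rank `≤ 1`** (over any field; the set of tensors of rank `≤ 1` is
closed under degeneration). [cite: LehmkuhlLickteig1989, Theorem (§1, p. 2), case r = 1] -/
theorem tensorRank_le_one_of_algBorderRank_le_one (t : ι → κ → μ → K)
    (ht : algBorderRank t ≤ 1) : tensorRank t ≤ 1 := by
  obtain ⟨h, hh⟩ := algBorderRank_attained t
  obtain ⟨u, v, w, hd⟩ := approxRank_attained h t
  exact tensorRank_le_one_of_isApproxDecomposition_le_one (hh ▸ ht) hd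

/-- `R̲(t) = 0` forces `t = 0` (over any field). [cite: Blaser2013, Def. 6.1] -/
theorem eq_zero_of_algBorderRank_eq_zero (t : ι → κ → μ → K) (ht : algBorderRank t = 0) :
    t = 0 := by
  obtain ⟨h, hh⟩ := algBorderRank_attained t
  obtain ⟨u, v, w, hd⟩ := approxRank_attained h t
  have h0 : ∀ {r : ℕ}, r = 0 → ∀ {u : Fin r → ι → K[X]} {v : Fin r → κ → K[X]}
      {w : Fin r → μ → K[X]}, IsApproxDecomposition h t u v w → t = 0 := by
    rintro r rfl u v w hd
    exact eq_zero_of_isApproxDecomposition_zero hd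
  exact h0 (hh.trans ht) hd

variable [DecidableEq ι] [DecidableEq κ] [DecidableEq μ]

/-- **The explicit bound for `r ≤ 1`, at every order and over every field**: if `R̲(t) ≤ r ≤ 1`
then `R_H(t) ≤ r` for all `H` (`r = 1`: `R_H(t) ≤ R(t) ≤ 1`; `r = 0`: `t = 0`).
[cite: LehmkuhlLickteig1989, Theorem (§1, p. 2), (ii) ⇒ (iii), case r ≤ 1] -/
theorem approxRank_le_of_algBorderRank_le_of_le_one (t : ι → κ → μ → K) {r : ℕ} (hr : r ≤ 1)
    (ht : algBorderRank t ≤ r) (H : ℕ) : approxRank H t ≤ r := by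
  rcases Nat.le_one_iff_eq_zero_or_eq_one.mp hr with rfl | rfl
  · rw [eq_zero_of_algBorderRank_eq_zero t (Nat.le_zero.mp ht)]
    exact (approxRank_le_tensorRank H (0 : ι → κ → μ → K)).trans (tensorRank_zero (K := K)).le
  · exact (approxRank_le_tensorRank H t).trans (tensorRank_le_one_of_algBorderRank_le_one t ht)

/-- **Lehmkuhl–Lickteig's Theorem, (ii) ⇒ (iii), in the case `r ≤ 1`** — PROVED, over every field
(not only algebraically closed ones): `R̲(t) ≤ r → R_h(t) ≤ r` for `h = δ(n,m,l)^r` (indeed for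
every order). The general case (`r ≥ 2`) is the named fact `LehmkuhlLickteig1989_explicitOrderBound`
(XL: degree of varieties, Bézout inequality, curve selection, places).
[cite: LehmkuhlLickteig1989, Theorem (§1, p. 2), (ii) ⇒ (iii), case r ≤ 1] -/
theorem LehmkuhlLickteig1989_explicitOrderBound_of_le_one (K : Type) [Field K] (n m l : ℕ)
    {r : ℕ} (hr : r ≤ 1) (t : Fin n → Fin m → Fin l → K) (ht : algBorderRank t ≤ r) :
    approxRank (lehmkuhlLickteigPowOrder n m l r) t ≤ r :=
  approxRank_le_of_algBorderRank_le_of_le_one t hr ht _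

end RankOne

/-! ### §6. Lehmkuhl–Lickteig's assembly step (§6 of the paper)

From rank-one tensors `s_ρ = u_ρ ⊗ v_ρ ⊗ w_ρ` over the fraction field `E` of a valuation ring
`D ⊇ K` (uniformiser `ϖ`, residue classes represented by `K`) whose ENTRIES have pole order `≤ h`
(`ϖ^h s_ρ ∈ D`) and whose sum is `≡ t (mod 𝔪_D)`, to `R_h(t) ≤ r` — with the order `h` of the
poles, not `3h`: "W.l.o.g. … `v_{ρj}, w_{ρk}` have order `0` … multiplying `u_ρ` by `εʰ` and passing
to `h`-jets" (source, p. 13). In the paper `D = k[[ε]]`, `E = k((ε))`, and the `s_ρ` come from a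
place of a curve `C ⊆ Sʳ` selected by Prop. 1 with `deg C ≤ deg Sʳ = δ^r`, the pole orders being
bounded by `deg C` (Corollary to Prop. 3); those two inputs are the part of the printed proof the
tree does not have. -/

section AssemblyStep

variable {K : Type*} [Field K] {D : Type*} [CommRing D] [IsDomain D] [ValuationRing D]
  [Algebra K D] {E : Type*} [Field E] [Algebra D E] [IsFractionRing D E]

omit [Algebra K D] in
/-- **Pivot entry.** A non-zero vector over the fraction field of a valuation ring has an entry
dividing all the others in the valuation ring (an entry of least valuation). [folklore] -/
theorem exists_pivot_entry {σ : Type*} [Finite σ] (v : σ → E) (hv : ∃ b, v b ≠ 0) :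
    ∃ b₀, v b₀ ≠ 0 ∧ ∀ b, ∃ d : D, algebraMap D E d * v b₀ = v b := by
  classical
  haveI := Fintype.ofFinite σ
  -- induction over the finite set of indices, comparing two entries at a time
  suffices H : ∀ s : Finset σ, (∃ b ∈ s, v b ≠ 0) →
      ∃ b₀ ∈ s, v b₀ ≠ 0 ∧ ∀ b ∈ s, ∃ d : D, algebraMap D E d * v b₀ = v b by
    obtain ⟨b, hb⟩ := hv
    obtain ⟨b₀, -, hb₀, hall⟩ := H Finset.univ ⟨b, Finset.mem_univ _, hb⟩
    exact ⟨b₀, hb₀, fun b => hall b (Finset.mem_univ _)⟩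
  intro s
  induction s using Finset.induction_on with
  | empty => rintro ⟨b, hb, -⟩; exact absurd hb (Finset.notMem_empty _)
  | insert b' s hb's ih =>
    rintro ⟨b₁, hb₁, hvb₁⟩
    by_cases hs : ∃ b ∈ s, v b ≠ 0
    · obtain ⟨b₀, hb₀s, hb₀, hall⟩ := ih hs
      -- compare `v b'` with the pivot `v b₀` of `s`
      rcases ValuationRing.isInteger_or_isInteger D (v b' / v b₀) with hint | hint
      · obtain ⟨d, hd⟩ := hint
        refine ⟨b₀, Finset.mem_insert_of_mem hb₀s, hb₀, fun b hb => ?_⟩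
        rcases Finset.mem_insert.mp hb with rfl | hb
        · exact ⟨d, by rw [hd, div_mul_cancel₀ _ hb₀]⟩
        · exact hall b hb
      · by_cases hvb' : v b' = 0
        · refine ⟨b₀, Finset.mem_insert_of_mem hb₀s, hb₀, fun b hb => ?_⟩
          rcases Finset.mem_insert.mp hb with rfl | hb
          · exact ⟨0, by rw [map_zero, zero_mul, hvb']⟩
          · exact hall b hb
        obtain ⟨d, hd⟩ := hint
        rw [inv_div] at hd
        refine ⟨b', Finset.mem_insert_self _ _, hvb', fun b hb => ?_⟩
        rcases Finset.mem_insert.mp hb with rfl | hb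
        · exact ⟨1, by rw [map_one, one_mul]⟩
        · obtain ⟨d', hd'⟩ := hall b hb
          refine ⟨d' * d, ?_⟩
          rw [map_mul, ← hd', hd, mul_assoc, div_mul_cancel₀ _ hvb']
    · -- all entries indexed by `s` vanish: the new entry is the pivot
      push Not at hs
      have hb₁' : b₁ = b' := by
        rcases Finset.mem_insert.mp hb₁ with h | h
        · exact h
        · exact absurd (hs b₁ h) hvb₁
      subst hb₁'
      refine ⟨b₁, Finset.mem_insert_self _ _, hvb₁, fun b hb => ?_⟩
      rcases Finset.mem_insert.mp hb with rfl | hb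
      · exact ⟨1, by rw [map_one, one_mul]⟩
      · exact ⟨0, by rw [map_zero, zero_mul, hs b hb]⟩

/-- **Lehmkuhl–Lickteig, §6: poles of order `≤ h` give `R_h(t) ≤ r`.** Let `D ⊇ K` be a
valuation ring with residue classes represented by `K` and maximal ideal `(ϖ)`, `ϖ ≠ 0`, and `E`
its field of fractions. If `u_ρ ∈ Eⁿ`, `v_ρ ∈ Eᵐ`, `w_ρ ∈ Eˡ` (`ρ < r`) are such that every ENTRY
of every `s_ρ = u_ρ ⊗ v_ρ ⊗ w_ρ` has a pole of order at most `h` (`ϖʰ u_{ρa} v_{ρb} w_{ρc} ∈ D`) and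
`∑_ρ s_ρ ≡ t (mod 𝔪_D)` entrywise (`∑_ρ s_ρ ∈ D` with residue `t`), then `R_h(t) ≤ r`. Proof as
printed (p. 13): rescale `v_ρ, w_ρ` by pivot entries to lie in `D` with a unit entry, so that
`u_{ρa} = s_{ρ a b₀ c₀}` carries the whole pole, multiply `u_ρ` by `ϖʰ`, and truncate `ϖ`-adic
expansions after order `h` (`exists_curve_of_aeval_eq_pow_mul`, the tree's form of "passing to
`h`-jets"). This is the step of the printed proof that turns the pole-order bound `h = deg Sʳ = δ^r`
into the order of approximation; the bound itself (Prop. 1, Prop. 3) is not formalised.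
[cite: LehmkuhlLickteig1989, §6 (pp. 12–13)] -/
theorem approxRank_le_of_poleOrder_le
    (hres : ∀ a : D, ∃ c : K, a - algebraMap K D c ∈ IsLocalRing.maximalIdeal D)
    {ϖ : D} (hϖ : IsLocalRing.maximalIdeal D = Ideal.span {ϖ}) (hϖ0 : ϖ ≠ 0)
    {ι κ μ : Type*} [Fintype ι] [Fintype κ] [Fintype μ]
    (h : ℕ) (t : ι → κ → μ → K) {r : ℕ} (u : Fin r → ι → E) (v : Fin r → κ → E)
    (w : Fin r → μ → E)
    (hpole : ∀ ρ a b c, ∃ d : D, algebraMap D E d = algebraMap D E ϖ ^ h * (u ρ a * v ρ b * w ρ c))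
    (hsum : ∀ a b c, ∃ m ∈ IsLocalRing.maximalIdeal D,
      ∑ ρ, u ρ a * v ρ b * w ρ c = algebraMap D E (algebraMap K D (t a b c) + m)) :
    approxRank h t ≤ r := by
  classical
  -- Step 1 (rescaling): integral triads `U_ρ ⊗ V_ρ ⊗ W_ρ = ϖ^h s_ρ` over `D`
  have step1 : ∀ ρ, ∃ (U : ι → D) (V : κ → D) (W : μ → D), ∀ a b c,
      algebraMap D E (U a * V b * W c) = algebraMap D E ϖ ^ h * (u ρ a * v ρ b * w ρ c) := by
    intro ρ
    by_cases hv : ∃ b, v ρ b ≠ 0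
    swap
    · push Not at hv
      exact ⟨0, 0, 0, fun a b c => by simp [hv b]⟩
    by_cases hw : ∃ c, w ρ c ≠ 0
    swap
    · push Not at hw
      exact ⟨0, 0, 0, fun a b c => by simp [hw c]⟩
    obtain ⟨b₀, hb₀, hV⟩ := exists_pivot_entry (D := D) (v ρ) hv
    obtain ⟨c₀, hc₀, hW⟩ := exists_pivot_entry (D := D) (w ρ) hw
    choose V hV using hV
    choose W hW using hW
    choose U hU using fun a => hpole ρ a b₀ c₀
    refine ⟨U, V, W, fun a b c => ?_⟩
    rw [map_mul, map_mul, hU a, ← hV b, ← hW c]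
    ring
  choose U V W hUVW using step1
  choose m hm hsum' using hsum
  -- Step 2: `∑_ρ U_ρ ⊗ V_ρ ⊗ W_ρ = ϖ^h (t + m)` in `D`
  have step2 : ∀ a b c, ∑ ρ, U ρ a * V ρ b * W ρ c =
      ϖ ^ h * (algebraMap K D (t a b c) + m a b c) := by
    intro a b c
    apply IsFractionRing.injective D E
    rw [map_sum, map_mul, map_pow, ← hsum' a b c, Finset.mul_sum]
    exact Finset.sum_congr rfl fun ρ _ => hUVW ρ a b c
  -- Step 3 (`h`-jets): truncate `ϖ`-adic expansions in the secant parametrisation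
  set P : ι × κ × μ → MvPolynomial ((Fin r × ι) ⊕ ((Fin r × κ) ⊕ (Fin r × μ))) K :=
    fun x => ∑ ρ : Fin r, X (Sum.inl (ρ, x.1)) * X (Sum.inr (Sum.inl (ρ, x.2.1))) *
      X (Sum.inr (Sum.inr (ρ, x.2.2))) with hPdef
  set pt : (Fin r × ι) ⊕ ((Fin r × κ) ⊕ (Fin r × μ)) → D :=
    Sum.elim (fun q => U q.1 q.2) (Sum.elim (fun q => V q.1 q.2) fun q => W q.1 q.2) with hptdef
  have hval : ∀ x : ι × κ × μ, ∃ m' ∈ IsLocalRing.maximalIdeal D,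
      MvPolynomial.aeval pt (P x) = ϖ ^ h * (algebraMap K D (t x.1 x.2.1 x.2.2) + m') := by
    intro x
    refine ⟨m x.1 x.2.1 x.2.2, hm _ _ _, ?_⟩
    rw [← step2]
    simp only [hPdef, hptdef, map_sum, map_mul, MvPolynomial.aeval_X, Sum.elim_inl, Sum.elim_inr]
  obtain ⟨p, hp⟩ := exists_curve_of_aeval_eq_pow_mul hres hϖ hϖ0 pt P
    (fun x => t x.1 x.2.1 x.2.2) h hval
  have happrox : IsApproxDecomposition h t (fun ρ a => p (Sum.inl (ρ, a)))
      (fun ρ b => p (Sum.inr (Sum.inl (ρ, b)))) (fun ρ c => p (Sum.inr (Sum.inr (ρ, c)))) := by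
    intro a b c j hj
    have hpx := hp (a, b, c) j hj
    have e : MvPolynomial.aeval p (P (a, b, c)) =
        ∑ ρ, p (Sum.inl (ρ, a)) * p (Sum.inr (Sum.inl (ρ, b))) * p (Sum.inr (Sum.inr (ρ, c))) := by
      simp only [hPdef, map_sum, map_mul, MvPolynomial.aeval_X]
    rw [e] at hpx
    exact hpx
  exact approxRank_le_of_isApproxDecomposition happrox

/-- **Rank one over a field from the quadratic relations of the Segre cone.** If the entries of
`s ∈ E^{ι×κ×μ}` satisfy the `2 × 2` minors of the flattening `ι | κ×μ` and of the slices
`s(a,·,·)`, then `s = u ⊗ v ⊗ w` for vectors over `E` ("Choose `u_{ρi}, v_{ρj}, w_{ρk} ∈ k((ε))`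
such that `u_{ρi} v_{ρj} w_{ρk} = s_{ρijk}`", source p. 13 — the `s_ρ` satisfy the relations of
`S`, Corollary (a)(ii) to Prop. 3, among which are these minors). [cite: LehmkuhlLickteig1989, §6 (p. 13)] -/
theorem exists_eq_triad_of_minors {E : Type*} [Field E] {ι κ μ : Type*} (s : ι → κ → μ → E)
    (h1 : ∀ a a' b b' c c', s a b c * s a' b' c' = s a b' c' * s a' b c)
    (h2 : ∀ a b b' c c', s a b c * s a b' c' = s a b c' * s a b' c) :
    ∃ (u : ι → E) (v : κ → E) (w : μ → E), ∀ a b c, s a b c = u a * v b * w c := by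
  by_cases hs : ∀ a b c, s a b c = 0
  · exact ⟨0, 0, 0, fun a b c => by simp [hs a b c]⟩
  push Not at hs
  obtain ⟨a₀, b₀, c₀, h0⟩ := hs
  refine ⟨fun a => s a b₀ c₀, fun b => s a₀ b c₀ / s a₀ b₀ c₀, fun c => s a₀ b₀ c / s a₀ b₀ c₀,
    fun a b c => ?_⟩
  have key : s a b c * s a₀ b₀ c₀ ^ 2 = s a b₀ c₀ * s a₀ b c₀ * s a₀ b₀ c := by
    have e1 := h1 a a₀ b b₀ c c₀
    have e2 := h2 a₀ b b₀ c c₀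
    calc s a b c * s a₀ b₀ c₀ ^ 2 = (s a b c * s a₀ b₀ c₀) * s a₀ b₀ c₀ := by ring
      _ = s a b₀ c₀ * (s a₀ b c * s a₀ b₀ c₀) := by rw [e1]; ring
      _ = s a b₀ c₀ * s a₀ b c₀ * s a₀ b₀ c := by rw [e2]; ring
  field_simp
  linear_combination key

/-- **§6 with the rank-one factorisation included**: the same conclusion `R_h(t) ≤ r` from tensors
`s_ρ ∈ E^{ι×κ×μ}` satisfying the quadratic relations of the Segre cone (hence rank one over `E`,
`exists_eq_triad_of_minors`), with entries of pole order `≤ h` and `∑_ρ s_ρ ≡ t (mod 𝔪_D)` — the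
form in which the Corollary (a) to Prop. 3 delivers them (Laurent series satisfying the relations
of `Sʳ`, of order `≥ −h`, summing to `t` at `ε = 0`). [cite: LehmkuhlLickteig1989, §6 (pp. 12–13)] -/
theorem approxRank_le_of_poleOrder_le_of_minors
    (hres : ∀ a : D, ∃ c : K, a - algebraMap K D c ∈ IsLocalRing.maximalIdeal D)
    {ϖ : D} (hϖ : IsLocalRing.maximalIdeal D = Ideal.span {ϖ}) (hϖ0 : ϖ ≠ 0)
    {ι κ μ : Type*} [Fintype ι] [Fintype κ] [Fintype μ]
    (h : ℕ) (t : ι → κ → μ → K) {r : ℕ} (s : Fin r → ι → κ → μ → E)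
    (h1 : ∀ ρ a a' b b' c c', s ρ a b c * s ρ a' b' c' = s ρ a b' c' * s ρ a' b c)
    (h2 : ∀ ρ a b b' c c', s ρ a b c * s ρ a b' c' = s ρ a b c' * s ρ a b' c)
    (hpole : ∀ ρ a b c, ∃ d : D, algebraMap D E d = algebraMap D E ϖ ^ h * s ρ a b c)
    (hsum : ∀ a b c, ∃ m ∈ IsLocalRing.maximalIdeal D,
      ∑ ρ, s ρ a b c = algebraMap D E (algebraMap K D (t a b c) + m)) :
    approxRank h t ≤ r := by
  choose u v w huvw using fun ρ => exists_eq_triad_of_minors (s ρ) (h1 ρ) (h2 ρ)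
  refine approxRank_le_of_poleOrder_le hres hϖ hϖ0 h t u v w (fun ρ a b c => ?_) fun a b c => ?_
  · rw [← huvw]
    exact hpole ρ a b c
  · simp_rw [← huvw]
    exact hsum a b c

end AssemblyStep

/-! ### §7. The function-field core of Prop. 3: the order of `u` at a place is at most `[F : K(u)]`

LL89, proof of Proposition 3 (pp. 11–12): the normalisation `B` of the coordinate ring is "a
finitely generated free `k[u]`-module of rank `d := [K(C) : k(u)]`", and the orders `e_i` of `u` at
the places over `u = 0` satisfy `e_i ≤ ∑ e_j = d`. We prove the single-place inequality in the
tree's language (`AlderStrassenProofs.lean`, §C). Abstract core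
(`algebraMap_notMem_maximalIdeal_pow_succ_finrank`): if `B` is a free `A`-module of rank `d`,
`u ∈ A` is such that every element of `A` is a constant plus a multiple of `u` (`A/uA = K`), `Q` is
a maximal ideal of `B` and `D = B_Q` is a local domain with principal maximal ideal `(ϖ)`, then
`u ∉ 𝔪_D^{d+1}`. Proof: `D/𝔪^{d+1}` is spanned over `K` by the images of an `A`-basis of `B`
(every element of `B_Q` is congruent to an element of `B` modulo `𝔪^{d+1}`,
`Ideal.IsMaximal.exists_inv_pow`; every element of `B` is a `K`-combination of the basis modulo
`uB ⊆ 𝔪^{d+1}`), while `1, ϖ, …, ϖ^d` are `K`-linearly independent there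
(`coeff_eq_zero_of_aeval_mem_span_pow`), and `d + 1 ≤ d` is absurd. The function-field instance
(`algebraMap_notMem_maximalIdeal_pow_succ_finrank_of_transcendental`): `A = K[u]`, `u`
transcendental, `F/K(u)` finite separable, `B` the integral closure of `A` in `F` (Dedekind, free
of rank `[F : K(u)]` over the principal ideal domain `A`), `Q ∋ u` maximal, `D = B_Q` a discrete
valuation ring: `ord_Q(u) ≤ [F : K(u)]`. -/

section PlaceDegree

variable {K : Type*} [Field K]

/-- **Ramification at one prime is at most the rank** (abstract core of LL89's proof of Prop. 3,
pp. 11–12). Let `A ⊆ B` be `K`-algebras with `B` free of finite rank `d` over `A`, `u ∈ A` with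
`A = K + uA`, `Q` a maximal ideal of `B`, and `D = B_Q` a local domain over `K` whose maximal ideal
is principal, `𝔪_D = (ϖ)`, `ϖ ≠ 0`. Then `u ∉ 𝔪_D^{d+1}`.
[cite: LehmkuhlLickteig1989, Prop. 3 (§5, pp. 10–12), proof (`e_i ≤ ∑ e_j = d`)] -/
theorem algebraMap_notMem_maximalIdeal_pow_succ_finrank
    {A B D : Type*} [CommRing A] [Nontrivial A] [CommRing B] [Algebra A B] [Module.Free A B]
    [Module.Finite A B]
    [Algebra K A] [Algebra K B] [IsScalarTower K A B]
    (uA : A) (hcoef : ∀ a : A, ∃ (c : K) (a' : A), a = algebraMap K A c + uA * a')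
    (Q : Ideal B) [Q.IsMaximal]
    [CommRing D] [IsDomain D] [IsLocalRing D] [Algebra B D] [IsLocalization.AtPrime D Q]
    [Algebra K D] [IsScalarTower K B D]
    {ϖ : D} (hϖ : IsLocalRing.maximalIdeal D = Ideal.span {ϖ}) (hϖ0 : ϖ ≠ 0) :
    algebraMap B D (algebraMap A B uA) ∉
      IsLocalRing.maximalIdeal D ^ (Module.finrank A B + 1) := by
  classical
  intro hmem
  have hI : IsLocalRing.maximalIdeal D ^ (Module.finrank A B + 1) =
      Ideal.span {ϖ ^ (Module.finrank A B + 1)} := by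
    rw [hϖ, Ideal.span_singleton_pow]
  -- (c) every element of `D` is congruent to an element of `B` modulo `𝔪^(d+1)`
  have happrox : ∀ δ : D, ∃ β : B,
      δ - algebraMap B D β ∈ IsLocalRing.maximalIdeal D ^ (Module.finrank A B + 1) := by
    intro δ
    obtain ⟨b, s, rfl⟩ := IsLocalization.exists_mk'_eq Q.primeCompl δ
    obtain ⟨y, i, hi, hyi⟩ :=
      Ideal.IsMaximal.exists_inv_pow Q (x := (s : B)) s.2 (Module.finrank A B + 1)
    refine ⟨b * y, ?_⟩
    have h3 : IsLocalization.mk' D b s * algebraMap B D s = algebraMap B D b :=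
      IsLocalization.mk'_spec D b s
    have h4 := congrArg (algebraMap B D) hyi
    rw [map_add, map_mul, map_one] at h4
    have e2 : IsLocalization.mk' D b s - algebraMap B D (b * y) =
        IsLocalization.mk' D b s * algebraMap B D i := by
      rw [map_mul]
      linear_combination (-(IsLocalization.mk' D b s)) * h4 + (algebraMap B D y) * h3
    rw [e2]
    refine Ideal.mul_mem_left _ _ ?_
    have him : algebraMap B D i ∈ Ideal.map (algebraMap B D) (Q ^ (Module.finrank A B + 1)) :=
      Ideal.mem_map_of_mem _ hi
    rwa [Ideal.map_pow, IsLocalization.AtPrime.map_eq_maximalIdeal Q D] at him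
  -- (d) every element of `B` is a `K`-combination of an `A`-basis modulo `u B`
  set bs := Module.Free.chooseBasis A B with hbsdef
  have hred : ∀ β : B, ∃ c : Module.Free.ChooseBasisIndex A B → K,
      β - ∑ j, algebraMap K B (c j) * bs j ∈ Ideal.span {algebraMap A B uA} := by
    intro β
    have hrepr : β = ∑ j, (bs.repr β j) • bs j := (bs.sum_repr β).symm
    choose c a' hca' using fun j => hcoef (bs.repr β j)
    refine ⟨c, Ideal.mem_span_singleton'.mpr ⟨∑ j, algebraMap A B (a' j) * bs j, ?_⟩⟩
    conv_rhs => rw [hrepr]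
    rw [Finset.sum_mul, ← Finset.sum_sub_distrib]
    refine Finset.sum_congr rfl fun j _ => ?_
    rw [Algebra.smul_def, hca' j, map_add, map_mul, ← IsScalarTower.algebraMap_apply K A B]
    ring
  -- (e) the `K`-module `W = D ⧸ 𝔪^(d+1)` is spanned by the `d` images of the basis …
  set I : Ideal D := IsLocalRing.maximalIdeal D ^ (Module.finrank A B + 1) with hIdef
  set π : D →ₐ[K] D ⧸ I := Ideal.Quotient.mkₐ K I with hπdef
  have hπker : ∀ x : D, x ∈ I → π x = 0 := fun x hx => by
    rw [hπdef, Ideal.Quotient.mkₐ_eq_mk, Ideal.Quotient.eq_zero_iff_mem]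
    exact hx
  have hspan : Submodule.span K (Set.range fun j => π (algebraMap B D (bs j))) = ⊤ := by
    rw [eq_top_iff]
    rintro x -
    obtain ⟨δ, rfl⟩ := Ideal.Quotient.mkₐ_surjective K I x
    obtain ⟨β, hβ⟩ := happrox δ
    obtain ⟨c, hc⟩ := hred β
    rw [Ideal.mem_span_singleton'] at hc
    obtain ⟨γ, hγ⟩ := hc
    have e1 : π δ = π (algebraMap B D β) := by
      rw [← sub_eq_zero, ← map_sub]
      exact hπker _ hβ
    have e2 : π (algebraMap B D β) = ∑ j, c j • π (algebraMap B D (bs j)) := by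
      have hβeq : algebraMap B D β = ∑ j, algebraMap K D (c j) * algebraMap B D (bs j) +
          algebraMap B D γ * algebraMap B D (algebraMap A B uA) := by
        have h := congrArg (algebraMap B D) hγ
        rw [map_mul, map_sub, map_sum] at h
        simp only [map_mul, ← IsScalarTower.algebraMap_apply K B D] at h
        linear_combination -h
      rw [hβeq, map_add, map_sum]
      have hz : π (algebraMap B D γ * algebraMap B D (algebraMap A B uA)) = 0 :=
        hπker _ (Ideal.mul_mem_left _ _ hmem)
      rw [hz, add_zero]
      refine Finset.sum_congr rfl fun j _ => ?_
      rw [map_mul, Algebra.smul_def, AlgHom.commutes]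
    rw [← hπdef, e1, e2]
    exact Submodule.sum_mem _ fun j _ =>
      Submodule.smul_mem _ _ (Submodule.subset_span ⟨j, rfl⟩)
  -- … while the `d+1` powers of `ϖ` are linearly independent over `K`
  have hli : LinearIndependent K fun i : Fin (Module.finrank A B + 1) => π (ϖ ^ (i : ℕ)) := by
    rw [Fintype.linearIndependent_iff]
    intro g hg i
    set P : K[X] := ∑ i : Fin (Module.finrank A B + 1),
      Polynomial.C (g i) * Polynomial.X ^ (i : ℕ) with hPdef
    have hPeval : Polynomial.aeval ϖ P =
        ∑ i : Fin (Module.finrank A B + 1), algebraMap K D (g i) * ϖ ^ (i : ℕ) := by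
      simp only [hPdef, map_sum, map_mul, map_pow, Polynomial.aeval_C, Polynomial.aeval_X]
    have hP : Polynomial.aeval ϖ P ∈ Ideal.span {ϖ ^ (Module.finrank A B + 1)} := by
      rw [← hI, ← Ideal.Quotient.eq_zero_iff_mem, hPeval, map_sum, ← hg]
      refine Finset.sum_congr rfl fun i _ => ?_
      rw [map_mul, map_pow, Algebra.smul_def, hπdef, Ideal.Quotient.mkₐ_eq_mk, map_pow,
        Ideal.Quotient.mk_algebraMap]
    have hc := coeff_eq_zero_of_aeval_mem_span_pow hϖ hϖ0 hP i i.2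
    have hcoeffP : P.coeff i = g i := by
      simp only [hPdef, Polynomial.finsetSum_coeff, Polynomial.coeff_C_mul_X_pow]
      rw [Finset.sum_eq_single i]
      · rw [if_pos rfl]
      · intro j _ hj
        rw [if_neg fun h => hj (Fin.ext h.symm)]
      · intro h
        exact absurd (Finset.mem_univ i) h
    rw [← hcoeffP]
    exact hc
  -- (f) count: `d + 1 ≤ d`
  have hcard := linearIndependent_le_span_finset _ hli
    (Finset.univ.image fun j => π (algebraMap B D (bs j)))
    (by rw [Finset.coe_image, Finset.coe_univ, Set.image_univ]; exact hspan)
  have h1 : (Finset.univ.image fun j => π (algebraMap B D (bs j))).card ≤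
      Fintype.card (Module.Free.ChooseBasisIndex A B) :=
    Finset.card_image_le.trans (by simp)
  have h2 : Fintype.card (Module.Free.ChooseBasisIndex A B) = Module.finrank A B :=
    (Module.finrank_eq_card_chooseBasisIndex A B).symm
  rw [Cardinal.mk_fin] at hcard
  norm_cast at hcard
  omega

open IntermediateField
open scoped IntermediateField.algebraAdjoinAdjoin

variable {F : Type*} [Field F] [Algebra K F]
set_option maxHeartbeats 400000 in -- buildfix (bf3-g27): 160k/180k FAIL, 200k PASS at accept time; line-neutral budget line
set_option synthInstance.maxHeartbeats 80000 in
/-- **Order at a place versus degree** (LL89, proof of Prop. 3, pp. 11–12: `e_i ≤ ∑_j e_j = d =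
[K(C) : k(u)]`, `B` free of rank `d` over `k[u]`). Let `u ∈ F` be transcendental over `K` with
`F/K(u)` finite and separable, `B` the integral closure of `K[u]` in `F` (a Dedekind domain, free
of rank `d = [F : K(u)]` over the principal ideal domain `K[u]`), `Q` a maximal ideal of `B`
containing `u`, and `D = B_Q` its local ring (any localisation of `B` at `Q`; a discrete
valuation ring). Then `u ∉ 𝔪_D^{d+1}` where `d = rank_{K[u]} B` (`= [F : K(u)]`,
`IsIntegralClosure.rank`; the exponent is stated as the rank to keep the statement free of the
`K(u)`-module structure of `F`): the order of `u` at the place `Q` is at most `[F : K(u)]`.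
[cite: LehmkuhlLickteig1989, Prop. 3 (§5, pp. 10–12), proof] -/
theorem algebraMap_notMem_maximalIdeal_pow_succ_finrank_of_transcendental {u : F}
    (hu : Transcendental K u) [FiniteDimensional K⟮u⟯ F] [Algebra.IsSeparable K⟮u⟯ F]
    (Q : Ideal (integralClosure (Algebra.adjoin K ({u} : Set F)) F)) [Q.IsMaximal]
    (huQ : algebraMap (Algebra.adjoin K ({u} : Set F))
      (integralClosure (Algebra.adjoin K ({u} : Set F)) F)
      ⟨u, Algebra.self_mem_adjoin_singleton K u⟩ ∈ Q)
    (D : Type*) [CommRing D] [IsDomain D] [IsLocalRing D]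
    [Algebra (integralClosure (Algebra.adjoin K ({u} : Set F)) F) D] [IsLocalization.AtPrime D Q] :
    algebraMap (integralClosure (Algebra.adjoin K ({u} : Set F)) F) D
        (algebraMap (Algebra.adjoin K ({u} : Set F))
          (integralClosure (Algebra.adjoin K ({u} : Set F)) F)
          ⟨u, Algebra.self_mem_adjoin_singleton K u⟩) ∉
      IsLocalRing.maximalIdeal D ^
        (Module.finrank (Algebra.adjoin K ({u} : Set F))
          (integralClosure (Algebra.adjoin K ({u} : Set F)) F) + 1) := by
  classical
  -- (a) `A = K[u]` is a principal ideal domain; `B` is Dedekind, finite free of rank `d` over `A`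
  have hmemA : ∀ q : K[X], Polynomial.aeval u q ∈ Algebra.adjoin K ({u} : Set F) := fun q => by
    rw [Algebra.adjoin_singleton_eq_range_aeval]
    exact ⟨q, rfl⟩
  haveI hPIR : IsPrincipalIdealRing (Algebra.adjoin K ({u} : Set F)) := by
    refine IsPrincipalIdealRing.of_surjective
      ((Polynomial.aeval u : K[X] →ₐ[K] F).toRingHom.codRestrict
        (Algebra.adjoin K ({u} : Set F)).toSubring hmemA) ?_
    rintro ⟨v, hv⟩
    rw [Algebra.adjoin_singleton_eq_range_aeval] at hv
    obtain ⟨q, rfl⟩ := hv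
    exact ⟨q, rfl⟩
  haveI : Algebra.IsAlgebraic K⟮u⟯ F := Algebra.IsSeparable.isAlgebraic K⟮u⟯ F
  haveI hT : IsScalarTower (Algebra.adjoin K ({u} : Set F))
      (integralClosure (Algebra.adjoin K ({u} : Set F)) F) F :=
    IsScalarTower.subalgebra' _ _ _ _
  haveI hT' : IsScalarTower K (Algebra.adjoin K ({u} : Set F))
      (integralClosure (Algebra.adjoin K ({u} : Set F)) F) :=
    IsScalarTower.of_algebraMap_eq fun _ => rfl
  haveI hT'' : IsScalarTower K (integralClosure (Algebra.adjoin K ({u} : Set F)) F) F :=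
    IsScalarTower.of_algebraMap_eq fun _ => rfl
  haveI hBD : IsDedekindDomain (integralClosure (Algebra.adjoin K ({u} : Set F)) F) :=
    integralClosure.isDedekindDomain (Algebra.adjoin K ({u} : Set F)) K⟮u⟯ F
  haveI hBfin : Module.Finite (Algebra.adjoin K ({u} : Set F))
      (integralClosure (Algebra.adjoin K ({u} : Set F)) F) :=
    IsIntegralClosure.finite (Algebra.adjoin K ({u} : Set F)) K⟮u⟯ F _
  haveI hBfree : Module.Free (Algebra.adjoin K ({u} : Set F))
      (integralClosure (Algebra.adjoin K ({u} : Set F)) F) :=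
    IsIntegralClosure.module_free (Algebra.adjoin K ({u} : Set F)) K⟮u⟯ F _
  -- (b) `Q ≠ 0`, so `D = B_Q` is a discrete valuation ring; a uniformiser `ϖ`
  have hu0 : u ≠ 0 := fun h => hu (h ▸ isAlgebraic_zero)
  have hQ0 : Q ≠ ⊥ := by
    intro hQ
    rw [hQ, Ideal.mem_bot] at huQ
    apply hu0
    have h := congrArg (algebraMap (integralClosure (Algebra.adjoin K ({u} : Set F)) F) F) huQ
    rwa [map_zero, ← IsScalarTower.algebraMap_apply] at h
  haveI hDVR : IsDiscreteValuationRing D :=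
    IsLocalization.AtPrime.isDiscreteValuationRing_of_dedekind_domain
      (integralClosure (Algebra.adjoin K ({u} : Set F)) F) hQ0 D
  obtain ⟨ϖ, hϖ⟩ := IsDiscreteValuationRing.exists_irreducible D
  -- `D` as a `K`-algebra through `B`
  letI : Algebra K D :=
    ((algebraMap (integralClosure (Algebra.adjoin K ({u} : Set F)) F) D).comp
      (algebraMap K (integralClosure (Algebra.adjoin K ({u} : Set F)) F))).toAlgebra
  -- (no type ascription: the tower must be stated with the `Algebra.toSMul` instances, as the
  -- core lemma expects; a direct `SMul K B` search yields a different, slowly-unifiable path)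
  haveI := IsScalarTower.of_algebraMap_eq (R := K)
    (S := integralClosure (Algebra.adjoin K ({u} : Set F)) F) (A := D) fun _ => rfl
  -- (c) `A = K + uA`
  have hcoef : ∀ a : Algebra.adjoin K ({u} : Set F), ∃ (c : K) (a' : Algebra.adjoin K ({u} : Set F)),
      a = algebraMap K _ c + ⟨u, Algebra.self_mem_adjoin_singleton K u⟩ * a' := by
    intro a
    obtain ⟨q, hq⟩ : ∃ q : K[X], Polynomial.aeval u q = (a : F) := by
      obtain ⟨v, hv⟩ := a
      rw [Algebra.adjoin_singleton_eq_range_aeval] at hv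
      obtain ⟨q, hq⟩ := hv
      exact ⟨q, hq⟩
    refine ⟨q.coeff 0, ⟨Polynomial.aeval u q.divX, hmemA _⟩, Subtype.ext ?_⟩
    have hsplit : Polynomial.aeval u q =
        algebraMap K F (q.coeff 0) + u * Polynomial.aeval u q.divX := by
      conv_lhs => rw [← Polynomial.X_mul_divX_add q]
      simp only [map_add, map_mul, Polynomial.aeval_X, Polynomial.aeval_C]
      ring
    rw [← hq, hsplit]
    rfl
  exact algebraMap_notMem_maximalIdeal_pow_succ_finrank _ hcoef Q hϖ.maximalIdeal_eq hϖ.ne_zero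

end PlaceDegree

/-! ### §8. The spine of the printed proof, closed modulo its degree-theoretic input

LL89 §6 proves (ii) ⇒ (iii) for `t ∈ cl(im ψ) ∖ im ψ` from "Proposition 1 and the corollary to
Proposition 3": formal Laurent series `s_{ρijk} ∈ k((ε))`, `ord ≥ −h`, satisfying the relations of
`Sʳ`, with `(∑_ρ s_ρ)(ε = 0) = t`, `h = deg Sʳ = δ^r`. In the tree's language (a place `O` of a
function field `E/K` in one variable in lieu of `k[[ε]] ⊂ k((ε))`, cf. `AlderStrassenProofs.lean`
§C) this section proves the Theorem from exactly that input, stated as an explicit hypothesis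
(`LehmkuhlLickteig1989_explicitOrderBound_of_poleOrderBound`), and — one layer down — from the
DEGREE bound `[E : K(g)] ≤ δ^r` for a pivot entry `g` that Prop. 3 consumes
(`LehmkuhlLickteig1989_explicitOrderBound_of_degreeBound`, via §7). What these hypotheses still
ask for is curve selection with degree control (Prop. 1, affine Bézout inequality) and
`deg Sʳ = δ^r`; nothing else of the printed proof is missing. -/

section PlacePackage

open IntermediateField
open scoped IntermediateField.algebraAdjoinAdjoin

variable {K : Type*} [Field K]

/-- In a local domain whose maximal ideal is principal, `𝔪 = (ϖ)`, an element outside `𝔪^{k+1}`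
is `ϖ^e · v` with `e ≤ k` and `v` a unit. [folklore] -/
theorem exists_eq_pow_mul_unit_of_notMem_pow {D : Type*} [CommRing D] [IsDomain D] [IsLocalRing D]
    {ϖ : D} (hϖ : IsLocalRing.maximalIdeal D = Ideal.span {ϖ}) (k : ℕ) {w : D}
    (hw : w ∉ IsLocalRing.maximalIdeal D ^ (k + 1)) :
    ∃ e ≤ k, ∃ v : Dˣ, w = ϖ ^ e * v := by
  induction k generalizing w with
  | zero =>
    rw [zero_add, pow_one] at hw
    obtain ⟨v, rfl⟩ := IsLocalRing.notMem_maximalIdeal.mp hw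
    exact ⟨0, le_rfl, v, by rw [pow_zero, one_mul]⟩
  | succ k ih =>
    by_cases hunit : w ∈ IsLocalRing.maximalIdeal D
    · rw [hϖ, Ideal.mem_span_singleton'] at hunit
      obtain ⟨w₁, rfl⟩ := hunit
      have hw₁ : w₁ ∉ IsLocalRing.maximalIdeal D ^ (k + 1) := by
        intro h1
        apply hw
        have hϖmem : ϖ ∈ IsLocalRing.maximalIdeal D := by
          rw [hϖ]
          exact Ideal.mem_span_singleton_self ϖ
        rw [pow_succ]
        exact Ideal.mul_mem_mul h1 hϖmem
      obtain ⟨e, he, v, rfl⟩ := ih hw₁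
      exact ⟨e + 1, by omega, v, by ring⟩
    · obtain ⟨v, rfl⟩ := IsLocalRing.notMem_maximalIdeal.mp hunit
      exact ⟨0, Nat.zero_le _, v, by rw [pow_zero, one_mul]⟩

variable {E : Type*} [Field E] [Algebra K E]

/-- **`O = B_Q` is a discrete valuation ring with residue field `K`, read in `O`** (abstract form;
BCS Lemma (20.28)): for a finitely generated `K`-algebra `B ⊆ O` (`K` algebraically closed) which
is a Dedekind domain with fraction field `E`, and a valuation ring `O ≠ E` of `E`, the maximal
ideal of `O` is generated by a non-zero `ϖ` (the image of a uniformiser of `B_Q`,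
`Q = 𝔪_O ∩ B ≠ 0`, under `B_Q ≅ O`) and every element of `O` is congruent to a constant modulo
`𝔪_O` (Nullstellensatz in `B_Q`). [cite: BurgisserClausenShokrollahi1997, Lemma (20.28) (proof)] -/
theorem exists_uniformizer_of_dedekind [IsAlgClosed K] {B : Type*} [CommRing B]
    [IsDedekindDomain B] [Algebra K B] [Algebra.FiniteType K B] [Algebra B E] [IsFractionRing B E]
    [IsScalarTower K B E] (O : ValuationSubring E) (hO : O ≠ ⊤)
    (hBO : ∀ b : B, algebraMap B E b ∈ O) :
    ∃ ϖ : O, ϖ ≠ 0 ∧ IsLocalRing.maximalIdeal O = Ideal.span {ϖ} ∧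
      ∀ a : O, ∃ c : K, (a : E) - algebraMap K E c ∈ O.nonunits := by
  classical
  -- the centre `Q = 𝔪_O ∩ B ≠ 0`, `D = B_Q` a discrete valuation ring, `ℓ : D → E`
  let f : B →+* O :=
    { toFun := fun b => ⟨algebraMap B E b, hBO b⟩
      map_one' := Subtype.ext (by simp)
      map_mul' := fun a b => Subtype.ext (by simp)
      map_zero' := Subtype.ext (by simp)
      map_add' := fun a b => Subtype.ext (by simp) }
  set Q : Ideal B := (IsLocalRing.maximalIdeal O).comap f with hQdef
  have hQ : ∀ b, b ∈ Q ↔ algebraMap B E b ∈ O.nonunits := fun b => by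
    rw [hQdef, Ideal.mem_comap, ← ValuationSubring.coe_mem_nonunits_iff]
    rfl
  haveI hQp : Q.IsPrime := Ideal.comap_isPrime f _
  have hQ0 : Q ≠ ⊥ := by
    intro hQbot
    apply hO
    refine _root_.eq_top_iff.mpr fun w _ => ?_
    obtain ⟨b₁, b₂, hb₂, rfl⟩ := IsFractionRing.div_surjective (A := B) w
    have hb₂Q : b₂ ∉ Q := by
      rw [hQbot, Ideal.mem_bot]
      exact nonZeroDivisors.ne_zero hb₂
    rw [div_eq_mul_inv]
    exact O.mul_mem _ _ (hBO b₁)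
      (valuationSubring_inv_mem_of_notMem_nonunits O fun h => hb₂Q ((hQ b₂).mpr h))
  haveI hQm : Q.IsMaximal := Ring.DimensionLEOne.maximalOfPrime hQ0 hQp
  haveI hDVR : IsDiscreteValuationRing (Localization.AtPrime Q) :=
    IsLocalization.AtPrime.isDiscreteValuationRing_of_dedekind_domain B hQ0 _
  obtain ⟨ϖ, hϖ⟩ := IsDiscreteValuationRing.exists_irreducible (Localization.AtPrime Q)
  have hunits : ∀ s : Q.primeCompl, IsUnit (algebraMap B E s) := fun s =>
    IsUnit.mk0 _ fun h => s.2 (by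
      rw [IsFractionRing.to_map_eq_zero_iff] at h
      rw [h]
      exact Q.zero_mem)
  set ℓ : Localization.AtPrime Q →+* E := IsLocalization.lift hunits with hℓdef
  have hℓ : ∀ b : B, ℓ (algebraMap B _ b) = algebraMap B E b := fun b =>
    IsLocalization.lift_eq hunits b
  have hℓK : ∀ c : K, ℓ (algebraMap K (Localization.AtPrime Q) c) = algebraMap K E c := by
    intro c
    rw [IsScalarTower.algebraMap_apply K B (Localization.AtPrime Q), hℓ,
      ← IsScalarTower.algebraMap_apply]
  have hres := fun w => exists_sub_algebraMap_mem_maximalIdeal_localization (K := K) Q w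
  -- transfer to `O = ℓ(D)`: the uniformiser `ℓ ϖ` and the residues
  have hℓmem : ∀ d, ℓ d ∈ O := lift_mem O Q ℓ hℓ hBO hQ
  refine ⟨⟨ℓ ϖ, hℓmem ϖ⟩, ?_, ?_, ?_⟩
  · intro h0
    have h1 : ℓ ϖ = 0 := congrArg Subtype.val h0
    exact hϖ.ne_zero ((map_eq_zero_iff ℓ (lift_injective Q ℓ hℓ)).mp h1)
  · apply le_antisymm
    · intro y hy
      have hyE : (y : E) ∈ O.nonunits := (ValuationSubring.coe_mem_nonunits_iff).mpr hy
      obtain ⟨d, hd⟩ := mem_range_lift_of_mem O Q ℓ hℓ hQ y.2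
      have hdmax : d ∈ IsLocalRing.maximalIdeal (Localization.AtPrime Q) :=
        mem_maximalIdeal_of_lift_mem_nonunits O Q ℓ hℓ hBO hQ (by rw [hd]; exact hyE)
      rw [hϖ.maximalIdeal_eq, Ideal.mem_span_singleton'] at hdmax
      obtain ⟨d', rfl⟩ := hdmax
      rw [Ideal.mem_span_singleton']
      refine ⟨⟨ℓ d', hℓmem d'⟩, Subtype.ext ?_⟩
      change ℓ d' * ℓ ϖ = (y : E)
      rw [← map_mul, hd]
    · rw [Ideal.span_singleton_le_iff_mem, ← ValuationSubring.coe_mem_nonunits_iff]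
      exact lift_mem_nonunits O Q ℓ hℓ hQ (hϖ.maximalIdeal_eq ▸ Ideal.mem_span_singleton_self ϖ)
  · intro a
    obtain ⟨d, hd⟩ := mem_range_lift_of_mem O Q ℓ hℓ hQ a.2
    obtain ⟨c, hc⟩ := hres d
    refine ⟨c, ?_⟩
    have e1 : (a : E) - algebraMap K E c = ℓ (d - algebraMap K (Localization.AtPrime Q) c) := by
      rw [map_sub, hd, hℓK]
    rw [e1]
    exact lift_mem_nonunits O Q ℓ hℓ hQ hc

set_option synthInstance.maxHeartbeats 80000 in
/-- **A place of a function field in one variable over an algebraically closed field is a discrete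
valuation ring with residue field `K`** (BCS Lemma (20.28): "`B_m` … a discrete valuation ring";
LL89 §5, p. 10: "`Ô_{x₀,C̃} = k[[ε]]`"), in the uniformiser-and-residues form consumed by the
truncation of `AlderStrassenProofs.lean` §B: for `E/K` finitely generated of transcendence degree
`1` (`x` transcendental, `E/K(x)` algebraic) over an algebraically closed `K` and a valuation ring
`O ≠ E` of `E` containing `K`, the maximal ideal of `O` is generated by a non-zero `ϖ` and every
element of `O` is congruent to a constant modulo `𝔪_O` (`exists_uniformizer_of_dedekind` for the
integral closure `B` of `K[u]`, `u ∈ O` separating).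
[cite: BurgisserClausenShokrollahi1997, Lemma (20.28) (proof); LehmkuhlLickteig1989, §5 (p. 10)] -/
theorem exists_uniformizer_of_valuationSubring [IsAlgClosed K] [Algebra.EssFiniteType K E]
    {x : E} (hx : Transcendental K x) (halg : Algebra.IsAlgebraic K⟮x⟯ E)
    (O : ValuationSubring E) (hO : O ≠ ⊤) (hKO : ∀ c : K, algebraMap K E c ∈ O) :
    ∃ ϖ : O, ϖ ≠ 0 ∧ IsLocalRing.maximalIdeal O = Ideal.span {ϖ} ∧
      ∀ a : O, ∃ c : K, (a : E) - algebraMap K E c ∈ O.nonunits := by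
  -- (a) a separating transcendental element `u ∈ O`
  obtain ⟨u, huO, hu, hsep⟩ := exists_separating_mem_valuationSubring hx halg O
  haveI := hsep
  -- (b) `A = K[u]` is a principal ideal domain and `E/K(u)` is finite (separable)
  haveI hPIR : IsPrincipalIdealRing (Algebra.adjoin K ({u} : Set E)) := by
    have hmem : ∀ q : K[X], Polynomial.aeval u q ∈ Algebra.adjoin K ({u} : Set E) := fun q => by
      rw [Algebra.adjoin_singleton_eq_range_aeval]
      exact ⟨q, rfl⟩
    refine IsPrincipalIdealRing.of_surjective
      ((Polynomial.aeval u : K[X] →ₐ[K] E).toRingHom.codRestrict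
        (Algebra.adjoin K ({u} : Set E)).toSubring hmem) ?_
    rintro ⟨v, hv⟩
    rw [Algebra.adjoin_singleton_eq_range_aeval] at hv
    obtain ⟨q, rfl⟩ := hv
    exact ⟨q, rfl⟩
  haveI : Algebra.IsAlgebraic K⟮u⟯ E := Algebra.IsSeparable.isAlgebraic K⟮u⟯ E
  haveI hfd : FiniteDimensional K⟮u⟯ E := finiteDimensional_of_essFiniteType K⟮u⟯
  -- (c) `B` = integral closure of `A` in `E`: Dedekind, finite over `A`, `Frac(B) = E`
  haveI hT : IsScalarTower (Algebra.adjoin K ({u} : Set E))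
      (integralClosure (Algebra.adjoin K ({u} : Set E)) E) E :=
    IsScalarTower.subalgebra' _ _ _ _
  haveI hT' : IsScalarTower K (Algebra.adjoin K ({u} : Set E))
      (integralClosure (Algebra.adjoin K ({u} : Set E)) E) :=
    IsScalarTower.of_algebraMap_eq fun _ => rfl
  haveI hT'' : IsScalarTower K (integralClosure (Algebra.adjoin K ({u} : Set E)) E) E :=
    IsScalarTower.of_algebraMap_eq fun _ => rfl
  haveI hBD : IsDedekindDomain (integralClosure (Algebra.adjoin K ({u} : Set E)) E) :=
    integralClosure.isDedekindDomain (Algebra.adjoin K ({u} : Set E)) K⟮u⟯ E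
  haveI hBfin : Module.Finite (Algebra.adjoin K ({u} : Set E))
      (integralClosure (Algebra.adjoin K ({u} : Set E)) E) :=
    IsIntegralClosure.finite (Algebra.adjoin K ({u} : Set E)) K⟮u⟯ E _
  haveI hBfrac : IsFractionRing (integralClosure (Algebra.adjoin K ({u} : Set E)) E) E :=
    integralClosure.isFractionRing_of_finite_extension K⟮u⟯ E
  haveI hAft : Algebra.FiniteType K (Algebra.adjoin K ({u} : Set E)) :=
    Algebra.FiniteType.adjoin_of_finite (Set.finite_singleton u)
  haveI hBft : Algebra.FiniteType K (integralClosure (Algebra.adjoin K ({u} : Set E)) E) :=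
    hAft.trans (Module.Finite.finiteType (integralClosure (Algebra.adjoin K ({u} : Set E)) E))
  -- (d) `B ⊆ O`: `A ⊆ O` and `O` is integrally closed
  let OK : Subalgebra K E := { O.toSubring with algebraMap_mem' := hKO }
  have hAO : Algebra.adjoin K ({u} : Set E) ≤ OK :=
    Algebra.adjoin_le (Set.singleton_subset_iff.mpr huO)
  have hBO : ∀ b : integralClosure (Algebra.adjoin K ({u} : Set E)) E,
      algebraMap _ E b ∈ O := by
    intro b
    have hb : IsIntegral (Algebra.adjoin K ({u} : Set E)) (b : E) := b.2
    obtain ⟨q, hqm, hq⟩ := hb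
    let g : Algebra.adjoin K ({u} : Set E) →+* O :=
      { toFun := fun a => ⟨(a : E), hAO a.2⟩
        map_one' := Subtype.ext (by simp)
        map_mul' := fun a b => Subtype.ext (by simp)
        map_zero' := Subtype.ext (by simp)
        map_add' := fun a b => Subtype.ext (by simp) }
    have hg : (algebraMap O E).comp g = algebraMap (Algebra.adjoin K ({u} : Set E)) E :=
      RingHom.ext fun a => rfl
    refine valuationSubring_mem_of_isIntegral O ⟨q.map g, hqm.map g, ?_⟩
    rw [Polynomial.eval₂_map, hg]
    exact hq
  exact exists_uniformizer_of_dedekind O hO hBO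

end PlacePackage

section Spine

open IntermediateField

/-- **The Theorem from the Corollary to Prop. 3 (fed by Prop. 1), i.e. from places with pole
order `≤ δ^r`.** Hypothesis `H` is the tree-language form of what LL89 §6 takes from
"Proposition 1 and the corollary to Proposition 3" (p. 12): for every tensor `t` in the secant
variety `X_r` but not in `S_r` there are a function field `E/K` in one variable (the function
field of the selected curve `C ⊆ Sʳ`), a place `O ∋ K`, `O ≠ E` (centred over `t`), an `E`-point
`s = (s_ρ)_ρ` of `Sʳ` (the quadratic relations of the Segre cone hold) with `∑_ρ s_ρ ≡ t (mod 𝔪_O)`,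
and an element `w ∈ O` of order `≤ h = δ(n,m,l)^r` clearing the poles of all entries
(`w s_{ρijk} ∈ O`; in the paper `w = ε^h`, `ord s_{ρijk} ≥ −h`, `h = deg Sʳ`). CONCLUSION: the
explicit order bound `LehmkuhlLickteig1989_explicitOrderBound`. Proof: `t ∈ S_r` gives `R_0(t) ≤ r`;
otherwise `O` is a discrete valuation ring with residue field `K`
(`exists_uniformizer_of_valuationSubring`), `w = ϖ^e v` with `e ≤ h`, so `ϖ^h s_ρ ∈ O`
entrywise, and §6 (`approxRank_le_of_poleOrder_le_of_minors`, with `D = O`) yields `R_h(t) ≤ r`.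
What `H` still asks for is exactly the degree-theoretic part of the printed proof (Prop. 1:
curve selection with `deg C ≤ deg Sʳ`; `deg Sʳ = δ^r`; Prop. 3: pole order `≤ deg C`).
[cite: LehmkuhlLickteig1989, §6 (pp. 12–13), from Prop. 1 (§3) and the Corollary to Prop. 3 (§5)] -/
theorem LehmkuhlLickteig1989_explicitOrderBound_of_poleOrderBound
    (H : ∀ (K : Type) [Field K] [IsAlgClosed K] (n m l r : ℕ) (t : Fin n → Fin m → Fin l → K),
      t ∈ tensorZariskiClosure {s : Fin n → Fin m → Fin l → K | tensorRank s ≤ r} →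
      ¬ tensorRank t ≤ r →
      ∃ (E : Type) (_ : Field E) (_ : Algebra K E) (_ : Algebra.EssFiniteType K E)
        (x : E) (_ : Transcendental K x) (_ : Algebra.IsAlgebraic K⟮x⟯ E)
        (O : ValuationSubring E) (_ : O ≠ ⊤) (_ : ∀ c : K, algebraMap K E c ∈ O)
        (s : Fin r → Fin n → Fin m → Fin l → E),
        (∀ ρ a a' b b' c c', s ρ a b c * s ρ a' b' c' = s ρ a b' c' * s ρ a' b c) ∧
        (∀ ρ a b b' c c', s ρ a b c * s ρ a b' c' = s ρ a b c' * s ρ a b' c) ∧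
        (∀ a b c, (∑ ρ, s ρ a b c) - algebraMap K E (t a b c) ∈ O.nonunits) ∧
        ∃ w : O, w ∉ IsLocalRing.maximalIdeal O ^ (lehmkuhlLickteigPowOrder n m l r + 1) ∧
          ∀ ρ a b c, (w : E) * s ρ a b c ∈ O) :
    LehmkuhlLickteig1989_explicitOrderBound := by
  intro K _ _ n m l r t ht
  classical
  by_cases hrk : tensorRank t ≤ r
  · exact (approxRank_le_approxRank_of_le (Nat.zero_le _) t).trans
      ((approxRank_zero t).le.trans hrk)
  have htX : t ∈ tensorZariskiClosure {s : Fin n → Fin m → Fin l → K | tensorRank s ≤ r} :=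
    setOf_algBorderRank_le_subset_tensorZariskiClosure r ht
  obtain ⟨E, _, _, _, x, hx, halg, O, hO, hKO, s, h1, h2, hst, w, hw, hws⟩ :=
    H K n m l r t htX hrk
  obtain ⟨ϖ, hϖ0, hϖ, hres⟩ := exists_uniformizer_of_valuationSubring hx halg O hO hKO
  -- `O` as a `K`-algebra (through `K ⊆ O`)
  letI : Algebra K O := ((algebraMap K E).codRestrict O.toSubring hKO).toAlgebra
  have hKOE : ∀ c : K, algebraMap O E (algebraMap K O c) = algebraMap K E c := fun c => rfl
  have hres' : ∀ a : O, ∃ c : K, a - algebraMap K O c ∈ IsLocalRing.maximalIdeal O := by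
    intro a
    obtain ⟨c, hc⟩ := hres a
    refine ⟨c, ?_⟩
    rw [← ValuationSubring.coe_mem_nonunits_iff]
    exact hc
  -- `w = ϖ^e v`, `e ≤ h`
  obtain ⟨e, he, v, hwv⟩ :=
    exists_eq_pow_mul_unit_of_notMem_pow hϖ (lehmkuhlLickteigPowOrder n m l r) hw
  have hvinv : algebraMap O E ↑v⁻¹ * algebraMap O E v = 1 := by
    rw [← map_mul, Units.inv_mul, map_one]
  have hwE : (w : E) = algebraMap O E ϖ ^ e * algebraMap O E v := by
    rw [← map_pow, ← map_mul, ← hwv]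
    rfl
  refine approxRank_le_of_poleOrder_le_of_minors (K := K) (D := O) (E := E) hres' hϖ hϖ0
    (lehmkuhlLickteigPowOrder n m l r) t s h1 h2 (fun ρ a b c => ?_) fun a b c => ?_
  · -- the entries have poles of order `≤ h`: `ϖ^h s = ϖ^(h-e) v⁻¹ (w s)`
    refine ⟨ϖ ^ (lehmkuhlLickteigPowOrder n m l r - e) * ↑v⁻¹ *
      ⟨(w : E) * s ρ a b c, hws ρ a b c⟩, ?_⟩
    have e1 : algebraMap O E (⟨(w : E) * s ρ a b c, hws ρ a b c⟩ : O) = (w : E) * s ρ a b c :=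
      rfl
    rw [map_mul, map_mul, map_pow, e1, hwE]
    calc algebraMap O E ϖ ^ (lehmkuhlLickteigPowOrder n m l r - e) * algebraMap O E ↑v⁻¹ *
          (algebraMap O E ϖ ^ e * algebraMap O E ↑v * s ρ a b c)
        = algebraMap O E ϖ ^ (lehmkuhlLickteigPowOrder n m l r - e) * algebraMap O E ϖ ^ e *
            (algebraMap O E ↑v⁻¹ * algebraMap O E ↑v) * s ρ a b c := by ring
      _ = algebraMap O E ϖ ^ lehmkuhlLickteigPowOrder n m l r * s ρ a b c := by
          rw [hvinv, mul_one, ← pow_add, Nat.sub_add_cancel he]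
  · -- `∑_ρ s_ρ ≡ t (mod 𝔪_O)`
    refine ⟨⟨(∑ ρ, s ρ a b c) - algebraMap K E (t a b c), O.nonunits_subset (hst a b c)⟩,
      (ValuationSubring.coe_mem_nonunits_iff).mp (hst a b c), ?_⟩
    rw [map_add, hKOE]
    change ∑ ρ, s ρ a b c = algebraMap K E (t a b c) + ((∑ ρ, s ρ a b c) - algebraMap K E (t a b c))
    ring

end Spine

/-! #### One layer down: from the DEGREE bound `[E : K(u)] ≤ h` (what Prop. 3 consumes) -/

section DegreeLayer

open IntermediateField
open scoped IntermediateField.algebraAdjoinAdjoin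

universe v

variable {K : Type*} [Field K] {E : Type*} [Field E] [Algebra K E]

/-- Transfer of orders from `B_Q` to the place `O ⊇ B_Q` (abstract form): for a domain `B ⊆ O`
with fraction field `E`, `O` a valuation ring of `E`, `Q = 𝔪_O ∩ B`, and a localisation `D` of
`B` at `Q` which is a discrete valuation ring (so that `D → O` is an isomorphism of local rings:
`mem_range_lift_of_mem`, `lift_injective`), an element `b ∈ B` whose image in `D` lies outside
`𝔪_D^{k+1}` lies outside `𝔪_O^{k+1}`. [cite: BurgisserClausenShokrollahi1997, Lemma (20.28) (proof)] -/
theorem notMem_maximalIdeal_pow_succ_valuationSubring_of_localization {B : Type*} [CommRing B]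
    [IsDomain B] [Algebra B E] [IsFractionRing B E] (O : ValuationSubring E)
    (hBO : ∀ b : B, algebraMap B E b ∈ O) (Q : Ideal B) [Q.IsPrime]
    (hQ : ∀ b, b ∈ Q ↔ algebraMap B E b ∈ O.nonunits)
    {D : Type*} [CommRing D] [IsDomain D] [Algebra B D] [IsLocalization.AtPrime D Q]
    [IsDiscreteValuationRing D] {b : B} {k : ℕ}
    (hb : algebraMap B D b ∉ IsLocalRing.maximalIdeal D ^ (k + 1)) :
    (⟨algebraMap B E b, hBO b⟩ : O) ∉ IsLocalRing.maximalIdeal O ^ (k + 1) := by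
  classical
  -- the canonical map `ℓ : D → E` and its corestriction `ℓO : D → O`
  have hunits : ∀ s : Q.primeCompl, IsUnit (algebraMap B E s) := fun s =>
    IsUnit.mk0 _ fun h => s.2 (by
      rw [IsFractionRing.to_map_eq_zero_iff] at h
      rw [h]
      exact Q.zero_mem)
  set ℓ : D →+* E := IsLocalization.lift hunits with hℓdef
  have hℓ : ∀ b : B, ℓ (algebraMap B D b) = algebraMap B E b := fun b =>
    IsLocalization.lift_eq hunits b
  have hℓmem : ∀ d, ℓ d ∈ O := lift_mem O Q ℓ hℓ hBO hQ
  set ℓO : D →+* O := ℓ.codRestrict O.toSubring hℓmem with hℓOdef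
  have hℓO : ∀ d, ((ℓO d : O) : E) = ℓ d := fun d => rfl
  -- `ℓO` is a bijection matching the maximal ideals
  have hsurj : Function.Surjective ℓO := fun y => by
    obtain ⟨d, hd⟩ := mem_range_lift_of_mem O Q ℓ hℓ hQ y.2
    exact ⟨d, Subtype.ext hd⟩
  have hinj : Function.Injective ℓO := fun d₁ d₂ h12 =>
    lift_injective Q ℓ hℓ (by rw [← hℓO, ← hℓO, h12])
  have hmax : IsLocalRing.maximalIdeal O = Ideal.map ℓO (IsLocalRing.maximalIdeal D) := by
    apply le_antisymm
    · intro y hy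
      obtain ⟨d, rfl⟩ := hsurj y
      have hd : d ∈ IsLocalRing.maximalIdeal D :=
        mem_maximalIdeal_of_lift_mem_nonunits O Q ℓ hℓ hBO hQ
          ((ValuationSubring.coe_mem_nonunits_iff).mpr hy)
      exact Ideal.mem_map_of_mem _ hd
    · rw [Ideal.map_le_iff_le_comap]
      intro d hd
      rw [Ideal.mem_comap, ← ValuationSubring.coe_mem_nonunits_iff, hℓO]
      exact lift_mem_nonunits O Q ℓ hℓ hQ hd
  -- conclusion
  intro hmem
  rw [hmax, ← Ideal.map_pow, Ideal.mem_map_iff_of_surjective ℓO hsurj] at hmem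
  obtain ⟨d, hd, hdb⟩ := hmem
  have hdb' : ℓO d = ℓO (algebraMap B D b) := by
    rw [hdb]
    exact Subtype.ext (hℓ b).symm
  exact hb (hinj hdb' ▸ hd)

/-- Transfer of orders from the localisations `B_Q` to the place `O` (abstract form with the
centre constructed): for a Dedekind domain `B ⊆ O` with fraction field `E`, `O ≠ E` a valuation
ring of `E`, and `b ∈ B` a non-unit of `O` such that, for every maximal `Q ∋ b` and every
localisation `D` of `B` at `Q` which is a discrete valuation ring, the image of `b` in `D` lies
outside `𝔪_D^{k+1}`: then `b ∉ 𝔪_O^{k+1}` (take `Q = 𝔪_O ∩ B ≠ 0` and `D = B_Q ≅ O`).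
[cite: BurgisserClausenShokrollahi1997, Lemma (20.28) (proof)] -/
theorem notMem_maximalIdeal_pow_succ_valuationSubring {B : Type v} [CommRing B]
    [IsDedekindDomain B] [Algebra B E] [IsFractionRing B E] (O : ValuationSubring E) (hO : O ≠ ⊤)
    (hBO : ∀ b : B, algebraMap B E b ∈ O) {b : B} (hbO : algebraMap B E b ∈ O.nonunits) {k : ℕ}
    (hb : ∀ (Q : Ideal B) [Q.IsMaximal], b ∈ Q → ∀ (D : Type v) [CommRing D] [IsDomain D]
      [Algebra B D] [IsLocalization.AtPrime D Q] [IsDiscreteValuationRing D],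
      algebraMap B D b ∉ IsLocalRing.maximalIdeal D ^ (k + 1)) :
    (⟨algebraMap B E b, hBO b⟩ : O) ∉ IsLocalRing.maximalIdeal O ^ (k + 1) := by
  classical
  -- the centre `Q = 𝔪_O ∩ B ∋ b`, `Q ≠ 0` maximal, `B_Q` a discrete valuation ring
  let f : B →+* O :=
    { toFun := fun b => ⟨algebraMap B E b, hBO b⟩
      map_one' := Subtype.ext (by simp)
      map_mul' := fun a b => Subtype.ext (by simp)
      map_zero' := Subtype.ext (by simp)
      map_add' := fun a b => Subtype.ext (by simp) }
  set Q : Ideal B := (IsLocalRing.maximalIdeal O).comap f with hQdef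
  have hQ : ∀ b, b ∈ Q ↔ algebraMap B E b ∈ O.nonunits := fun b => by
    rw [hQdef, Ideal.mem_comap, ← ValuationSubring.coe_mem_nonunits_iff]
    rfl
  haveI hQp : Q.IsPrime := Ideal.comap_isPrime f _
  have hQ0 : Q ≠ ⊥ := by
    intro hQbot
    apply hO
    refine _root_.eq_top_iff.mpr fun w _ => ?_
    obtain ⟨b₁, b₂, hb₂, rfl⟩ := IsFractionRing.div_surjective (A := B) w
    have hb₂Q : b₂ ∉ Q := by
      rw [hQbot, Ideal.mem_bot]
      exact nonZeroDivisors.ne_zero hb₂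
    rw [div_eq_mul_inv]
    exact O.mul_mem _ _ (hBO b₁)
      (valuationSubring_inv_mem_of_notMem_nonunits O fun h => hb₂Q ((hQ b₂).mpr h))
  haveI hQm : Q.IsMaximal := Ring.DimensionLEOne.maximalOfPrime hQ0 hQp
  haveI hDVR : IsDiscreteValuationRing (Localization.AtPrime Q) :=
    IsLocalization.AtPrime.isDiscreteValuationRing_of_dedekind_domain B hQ0 _
  exact notMem_maximalIdeal_pow_succ_valuationSubring_of_localization O hBO Q hQ
    (hb Q ((hQ b).mpr hbO) (Localization.AtPrime Q))
set_option maxHeartbeats 400000 in -- buildfix (bf3-g27): 160k/180k FAIL, 200k PASS at accept time; line-neutral budget line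
set_option synthInstance.maxHeartbeats 80000 in
/-- **Order at a place versus degree, read in the place** (LL89 Prop. 3, function-field core,
pp. 11–12): for a valuation ring `O ∋ K` of `E` and a non-unit `u ∈ 𝔪_O` which is
transcendental over `K` with `E/K(u)` finite separable of degree `≤ k`: `u ∉ 𝔪_O^{k+1}` — the
order of `u` at the place `O` is at most `[E : K(u)]` (§7 in `B_Q` for the integral closure `B`
of `K[u]` and `Q = 𝔪_O ∩ B ∋ u`, transferred along `B_Q ≅ O`).
[cite: LehmkuhlLickteig1989, Prop. 3 (§5, pp. 10–12), proof] -/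
theorem notMem_maximalIdeal_pow_succ_of_finrank_le {u : E} (hu : Transcendental K u)
    [FiniteDimensional K⟮u⟯ E] [Algebra.IsSeparable K⟮u⟯ E]
    (O : ValuationSubring E) (hO : O ≠ ⊤) (hKO : ∀ c : K, algebraMap K E c ∈ O)
    (huO : u ∈ O.nonunits) {k : ℕ} (hk : Module.finrank K⟮u⟯ E ≤ k) :
    (⟨u, O.nonunits_subset huO⟩ : O) ∉ IsLocalRing.maximalIdeal O ^ (k + 1) := by
  classical
  -- (b) `A = K[u]` is a principal ideal domain and `E/K(u)` is finite separable
  haveI hPIR : IsPrincipalIdealRing (Algebra.adjoin K ({u} : Set E)) := by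
    have hmem : ∀ q : K[X], Polynomial.aeval u q ∈ Algebra.adjoin K ({u} : Set E) := fun q => by
      rw [Algebra.adjoin_singleton_eq_range_aeval]
      exact ⟨q, rfl⟩
    refine IsPrincipalIdealRing.of_surjective
      ((Polynomial.aeval u : K[X] →ₐ[K] E).toRingHom.codRestrict
        (Algebra.adjoin K ({u} : Set E)).toSubring hmem) ?_
    rintro ⟨v, hv⟩
    rw [Algebra.adjoin_singleton_eq_range_aeval] at hv
    obtain ⟨q, rfl⟩ := hv
    exact ⟨q, rfl⟩
  haveI : Algebra.IsAlgebraic K⟮u⟯ E := Algebra.IsSeparable.isAlgebraic K⟮u⟯ E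
  -- (c) `B` = integral closure of `A` in `E`: Dedekind, finite free over `A`, `Frac(B) = E`
  haveI hT : IsScalarTower (Algebra.adjoin K ({u} : Set E))
      (integralClosure (Algebra.adjoin K ({u} : Set E)) E) E :=
    IsScalarTower.subalgebra' _ _ _ _
  haveI hT' : IsScalarTower K (Algebra.adjoin K ({u} : Set E))
      (integralClosure (Algebra.adjoin K ({u} : Set E)) E) :=
    IsScalarTower.of_algebraMap_eq fun _ => rfl
  haveI hT'' : IsScalarTower K (integralClosure (Algebra.adjoin K ({u} : Set E)) E) E :=
    IsScalarTower.of_algebraMap_eq fun _ => rfl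
  haveI hBD : IsDedekindDomain (integralClosure (Algebra.adjoin K ({u} : Set E)) E) :=
    integralClosure.isDedekindDomain (Algebra.adjoin K ({u} : Set E)) K⟮u⟯ E
  haveI hBfin : Module.Finite (Algebra.adjoin K ({u} : Set E))
      (integralClosure (Algebra.adjoin K ({u} : Set E)) E) :=
    IsIntegralClosure.finite (Algebra.adjoin K ({u} : Set E)) K⟮u⟯ E _
  haveI hBfree : Module.Free (Algebra.adjoin K ({u} : Set E))
      (integralClosure (Algebra.adjoin K ({u} : Set E)) E) :=
    IsIntegralClosure.module_free (Algebra.adjoin K ({u} : Set E)) K⟮u⟯ E _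
  haveI hBfrac : IsFractionRing (integralClosure (Algebra.adjoin K ({u} : Set E)) E) E :=
    integralClosure.isFractionRing_of_finite_extension K⟮u⟯ E
  have hrank : Module.finrank (Algebra.adjoin K ({u} : Set E))
      (integralClosure (Algebra.adjoin K ({u} : Set E)) E) = Module.finrank K⟮u⟯ E :=
    IsIntegralClosure.rank (Algebra.adjoin K ({u} : Set E)) K⟮u⟯ E _
  have hle : Module.finrank (Algebra.adjoin K ({u} : Set E))
      (integralClosure (Algebra.adjoin K ({u} : Set E)) E) + 1 ≤ k + 1 := by
    rw [hrank]
    exact Nat.succ_le_succ hk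
  -- (d) `B ⊆ O`: `A ⊆ O` and `O` is integrally closed
  let OK : Subalgebra K E := { O.toSubring with algebraMap_mem' := hKO }
  have hAO : Algebra.adjoin K ({u} : Set E) ≤ OK :=
    Algebra.adjoin_le (Set.singleton_subset_iff.mpr (O.nonunits_subset huO))
  have hBO : ∀ b : integralClosure (Algebra.adjoin K ({u} : Set E)) E,
      algebraMap _ E b ∈ O := by
    intro b
    have hb : IsIntegral (Algebra.adjoin K ({u} : Set E)) (b : E) := b.2
    obtain ⟨q, hqm, hq⟩ := hb
    let g : Algebra.adjoin K ({u} : Set E) →+* O :=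
      { toFun := fun a => ⟨(a : E), hAO a.2⟩
        map_one' := Subtype.ext (by simp)
        map_mul' := fun a b => Subtype.ext (by simp)
        map_zero' := Subtype.ext (by simp)
        map_add' := fun a b => Subtype.ext (by simp) }
    have hg : (algebraMap O E).comp g = algebraMap (Algebra.adjoin K ({u} : Set E)) E :=
      RingHom.ext fun a => rfl
    refine valuationSubring_mem_of_isIntegral O ⟨q.map g, hqm.map g, ?_⟩
    rw [Polynomial.eval₂_map, hg]
    exact hq
  -- (e) the image of `u` in `B` maps to `u` in `E`; §7 in every `B_Q`, transferred to `O`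
  have hBE : algebraMap (integralClosure (Algebra.adjoin K ({u} : Set E)) E) E
      (algebraMap (Algebra.adjoin K ({u} : Set E))
        (integralClosure (Algebra.adjoin K ({u} : Set E)) E)
        ⟨u, Algebra.self_mem_adjoin_singleton K u⟩) = u := by
    rw [← IsScalarTower.algebraMap_apply]
    rfl
  have hbO : algebraMap (integralClosure (Algebra.adjoin K ({u} : Set E)) E) E
      (algebraMap (Algebra.adjoin K ({u} : Set E))
        (integralClosure (Algebra.adjoin K ({u} : Set E)) E)
        ⟨u, Algebra.self_mem_adjoin_singleton K u⟩) ∈ O.nonunits := by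
    rw [hBE]
    exact huO
  have key := notMem_maximalIdeal_pow_succ_valuationSubring O hO hBO hbO (k := k)
    fun Q _ huQ D _ _ _ _ _ hmem =>
      algebraMap_notMem_maximalIdeal_pow_succ_finrank_of_transcendental hu Q huQ D
        (Ideal.pow_le_pow_right hle hmem)
  have hsub : (⟨algebraMap (integralClosure (Algebra.adjoin K ({u} : Set E)) E) E
      (algebraMap (Algebra.adjoin K ({u} : Set E))
        (integralClosure (Algebra.adjoin K ({u} : Set E)) E)
        ⟨u, Algebra.self_mem_adjoin_singleton K u⟩), hBO _⟩ : O) =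
      ⟨u, O.nonunits_subset huO⟩ := Subtype.ext hBE
  rw [hsub] at key
  exact key

/-- **The Theorem from the DEGREE bound** (one layer below
`LehmkuhlLickteig1989_explicitOrderBound_of_poleOrderBound`): hypothesis `H` asks, for every
`t ∈ X_r ∖ S_r`, for a function field `E/K`, a place `O ∋ K`, `O ≠ E`, an `E`-point `s` of `Sʳ`
with `∑_ρ s_ρ ≡ t (mod 𝔪_O)`, and a PIVOT entry `g` (`s_{ρijk}/g ∈ O` for all entries, `g⁻¹ ∈ 𝔪_O`)
with `g⁻¹` transcendental, `E/K(g⁻¹)` finite separable and `[E : K(g⁻¹)] ≤ h = δ(n,m,l)^r` — the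
inequality LL89 obtain as `[K(C) : k(u)] = deg C ≤ deg Sʳ = δ^r` (Prop. 1 and §6, p. 12; the
separability is automatic in characteristic `0` and is Mathlib's price for the finiteness of
integral closures otherwise). CONCLUSION: `LehmkuhlLickteig1989_explicitOrderBound`, via
`notMem_maximalIdeal_pow_succ_of_finrank_le` (order of `g⁻¹` at `O` is `≤ h`) and the pole-order
form. [cite: LehmkuhlLickteig1989, §6 (pp. 12–13) with Prop. 3 (§5); Prop. 1 (§3) is the remaining input] -/
theorem LehmkuhlLickteig1989_explicitOrderBound_of_degreeBound
    (H : ∀ (K : Type) [Field K] [IsAlgClosed K] (n m l r : ℕ) (t : Fin n → Fin m → Fin l → K),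
      t ∈ tensorZariskiClosure {s : Fin n → Fin m → Fin l → K | tensorRank s ≤ r} →
      ¬ tensorRank t ≤ r →
      ∃ (E : Type) (_ : Field E) (_ : Algebra K E) (_ : Algebra.EssFiniteType K E)
        (O : ValuationSubring E) (_ : O ≠ ⊤) (_ : ∀ c : K, algebraMap K E c ∈ O)
        (s : Fin r → Fin n → Fin m → Fin l → E),
        (∀ ρ a a' b b' c c', s ρ a b c * s ρ a' b' c' = s ρ a b' c' * s ρ a' b c) ∧
        (∀ ρ a b b' c c', s ρ a b c * s ρ a b' c' = s ρ a b c' * s ρ a b' c) ∧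
        (∀ a b c, (∑ ρ, s ρ a b c) - algebraMap K E (t a b c) ∈ O.nonunits) ∧
        ∃ g : E, (∀ ρ a b c, s ρ a b c / g ∈ O) ∧ g⁻¹ ∈ O.nonunits ∧ Transcendental K g⁻¹ ∧
          ∃ (_ : FiniteDimensional K⟮g⁻¹⟯ E) (_ : Algebra.IsSeparable K⟮g⁻¹⟯ E),
            Module.finrank K⟮g⁻¹⟯ E ≤ lehmkuhlLickteigPowOrder n m l r) :
    LehmkuhlLickteig1989_explicitOrderBound := by
  refine LehmkuhlLickteig1989_explicitOrderBound_of_poleOrderBound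
    fun K _ _ n m l r t htX hrk => ?_
  obtain ⟨E, _, _, _, O, hO, hKO, s, h1, h2, hst, g, hsg, hg, hgt, _, _, hdeg⟩ :=
    H K n m l r t htX hrk
  haveI : Algebra.IsAlgebraic K⟮g⁻¹⟯ E := Algebra.IsAlgebraic.of_finite K⟮g⁻¹⟯ E
  refine ⟨E, inferInstance, inferInstance, inferInstance, g⁻¹, hgt, inferInstance, O, hO, hKO, s,
    h1, h2, hst, ⟨g⁻¹, O.nonunits_subset hg⟩,
    notMem_maximalIdeal_pow_succ_of_finrank_le hgt O hO hKO hg hdeg, fun ρ a b c => ?_⟩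
  change g⁻¹ * s ρ a b c ∈ O
  rw [← div_eq_inv_mul]
  exact hsg ρ a b c

end DegreeLayer

/-! #### The printed Corollary (a) verbatim: formal Laurent series -/

section LaurentLayer

open scoped LaurentSeries
open PowerSeries

/-- **The Theorem from LL89's Corollary (a) to Prop. 3 as printed — formal Laurent series.**
Hypothesis `H` is, word for word in the tree's vocabulary, what §6 of the paper (p. 12) takes
from "Proposition 1 and the corollary to Proposition 3": for `t ∈ cl(im ψ) ∖ im ψ` (here:
`t` in the secant variety `X_r`, not of rank `≤ r`) there are formal Laurent series
`s_{ρijk} ∈ k((ε))` with (ii) the relations of `Sʳ` (the quadratic relations of the Segre cone,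
triad by triad), (i) `ord s_{ρijk} ≥ −h` (`εʰ s_{ρijk} ∈ k[[ε]]`), `h = deg Sʳ = δ(n,m,l)^r`, and
(iii) `∑_ρ s_{ρijk} ∈ k[[ε]]` with `(∑_ρ s_{ρijk})(ε = 0) = t_{ijk}` (`= t_{ijk} + ε q_{ijk}`).
CONCLUSION: `LehmkuhlLickteig1989_explicitOrderBound` — by §6 with `D = k[[ε]]`, `E = k((ε))`
(a discrete valuation ring with residue field `k` and uniformiser `ε`). The hypothesis is the
degree-theoretic content of the paper (Prop. 1, `deg Sʳ = δ^r`, Prop. 3), not available in Mathlib.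
[cite: LehmkuhlLickteig1989, §6 (p. 12) with the Corollary (a) to Prop. 3 (§5, p. 12) and Prop. 1 (§3, p. 5)] -/
theorem LehmkuhlLickteig1989_explicitOrderBound_of_laurentPoints
    (H : ∀ (K : Type) [Field K] [IsAlgClosed K] (n m l r : ℕ) (t : Fin n → Fin m → Fin l → K),
      t ∈ tensorZariskiClosure {s : Fin n → Fin m → Fin l → K | tensorRank s ≤ r} →
      ¬ tensorRank t ≤ r →
      ∃ s : Fin r → Fin n → Fin m → Fin l → K⸨X⸩,
        (∀ ρ a a' b b' c c', s ρ a b c * s ρ a' b' c' = s ρ a b' c' * s ρ a' b c) ∧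
        (∀ ρ a b b' c c', s ρ a b c * s ρ a b' c' = s ρ a b c' * s ρ a b' c) ∧
        (∀ ρ a b c, ∃ d : K⟦X⟧, algebraMap K⟦X⟧ K⸨X⸩ d =
          algebraMap K⟦X⟧ K⸨X⸩ PowerSeries.X ^ lehmkuhlLickteigPowOrder n m l r * s ρ a b c) ∧
        (∀ a b c, ∃ q : K⟦X⟧, ∑ ρ, s ρ a b c =
          algebraMap K⟦X⟧ K⸨X⸩ (algebraMap K K⟦X⟧ (t a b c) + PowerSeries.X * q))) :
    LehmkuhlLickteig1989_explicitOrderBound := by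
  intro K _ _ n m l r t ht
  classical
  by_cases hrk : tensorRank t ≤ r
  · exact (approxRank_le_approxRank_of_le (Nat.zero_le _) t).trans
      ((approxRank_zero t).le.trans hrk)
  have htX : t ∈ tensorZariskiClosure {s : Fin n → Fin m → Fin l → K | tensorRank s ≤ r} :=
    setOf_algBorderRank_le_subset_tensorZariskiClosure r ht
  obtain ⟨s, h1, h2, hpole, hsum⟩ := H K n m l r t htX hrk
  -- `k[[ε]]`: residues in `k`, maximal ideal `(ε)`
  have hres : ∀ a : K⟦X⟧, ∃ c : K, a - algebraMap K K⟦X⟧ c ∈ IsLocalRing.maximalIdeal K⟦X⟧ := by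
    intro a
    refine ⟨PowerSeries.constantCoeff a, ?_⟩
    rw [PowerSeries.maximalIdeal_eq_span_X, Ideal.mem_span_singleton, PowerSeries.X_dvd_iff]
    simp
  refine approxRank_le_of_poleOrder_le_of_minors (K := K) (D := K⟦X⟧) (E := K⸨X⸩) hres
    PowerSeries.maximalIdeal_eq_span_X PowerSeries.X_ne_zero (lehmkuhlLickteigPowOrder n m l r)
    t s h1 h2 hpole fun a b c => ?_
  obtain ⟨q, hq⟩ := hsum a b c
  refine ⟨PowerSeries.X * q, ?_, hq⟩
  rw [PowerSeries.maximalIdeal_eq_span_X]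
  exact Ideal.mul_mem_right _ _ (Ideal.mem_span_singleton_self _)

end LaurentLayer

end Literature.Computability.AlgebraicComplexity

end
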